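import Literature.AlgebraicGeometry.ShimuraVarieties.UnitaryAuxiliarySymplecticAdelic
import HarnessLib

/-!
# The complex structure `J_{β,Φ}(z)` on the auxiliary symplectic space (Deligne's `h_W(i)`)

[cite: Deligne1979ShimuraVarieties, Prop. 2.3.10 (PDF p. 32 of Milne's translation)]
[cite: Milne2005ShimuraVarieties, §8 p. 81 («PEL data: h(i) is a complex structure J with ψ(Ju, Jv) = ψ(u, v)»)]
[cite: Shimura1998, §6.2 Thm. 4, p. 44 (the embedding `v : K → ℂ^Φ` of a CM type)]

Continuation of ★ `UnitaryAuxiliarySymplecticModule` (g-a2: `conjR`, `auxForm`, `SymplecticFrame`, `auxRep`,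
`isMultiplier_auxRep`) and ★ `UnitaryAuxiliarySymplecticAdelic` (g-a3).  For the auxiliary CM type `Φ` of `M`, a frame
`T ∈ GL₃(ℂ)` with `Tᴴ H^τ T = diag(1,1,-1)` at the distinguished embedding `τ : L → ℂ`, and a point `z` of the unit
ball `𝔹²`, we build the **real points** of Deligne's homomorphism `h` evaluated at `i`:

* §1 `realPi M Φ : ℝ ⊗_ℚ M ≃ₐ[ℝ] ℂ^Φ` (`r ⊗ x ↦ (r·ρ(x))_{ρ ∈ Φ}`, Shimura's `v`), with `1 ⊗ c ↦` componentwise `conj`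
  (`realPi_conjR`) and the evaluations `realEmb M Φ ρ : ℝ ⊗_ℚ M →ₐ[ℝ] ℂ`;
* §2 `iPhi M Φ ∈ (ℝ ⊗_ℚ M)ˣ`, the element with all `Φ`-components `i` (`iPhi² = -1`, `c(iPhi)·iPhi = 1`);
* §3 the `J`-reflection `reflJ w = 1 - 2·w(w̄ᵀJ)/(w̄ᵀJw)` in the negative vector `w = lift z = (z₀, z₁, 1)` and its
  transport `reflFrame T w = T·reflJ w·T⁻¹` to the frame of `H^τ` (`reflFrame² = 1`, `reflFrameᴴ H^τ reflFrame = H^τ`);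
* §4 `sPhi M j Φ τ T z ∈ GL₃(ℝ ⊗_ℚ M)`: `Φ`-component `reflFrame T (lift z)` at the `ρ ∈ Φ` over `τ`, `1` elsewhere
  — an involution, unitary for `H^j` (`sPhi_unitary`, the hypothesis `hX` of ★ `isMultiplier_auxRep`);
* §5 **`auxComplexStructure F τ Φ T z := auxRep ℝ F (iPhi, s_z) = β·diag(i, i·s_z)·β⁻¹`** as a real `2g × 2g` matrix
  (`auxComplexStructureGL` the same element of `GL_{g⊕g}(ℝ)`), with `auxComplexStructure_mul_self : J·J = -1`,
  `auxComplexStructureGL_mem_symplecticGroupOfForm : J ∈ Sp(E_δ)(ℝ)` (★ `isMultiplier_auxRep` with `ν = 1`),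
  `transpose_auxComplexStructure_mul_mul : ᵗJ E_δ J = E_δ`, `isSymplecticComplexStructure_auxComplexStructure`;
* §6 **positivity**: `trace_eq_two_mul_sum_re` (`Tr_{ℝ⊗M/ℝ} = 2 Re Σ_{ρ∈Φ}`), `traceForm_conjR_eq_sum`, the `U(J)`-equivariance
  `reflJ_mulVec_of_unitary` and `J·r_{lift z} = Nᴴ N` (`exists_J_mul_reflJ_lift_eq`, ★ `exists_smul_x₀_eq`),
  `traceForm_blockGL_mulVec_self_neg : ψ_ℝ(Ax, x) < 0`, `auxComplexStructure_mulVec_dotProduct : E_δ(Jv, v) = ψ_ℝ(Ax, x)`,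
  **`neg_auxComplexStructure_mem_C0`**, **`auxComplexStructure_mem_C0pm`** and the packaged point **`auxPoint … : C0pm δ`**,
  under the frame `Tᴴ H^τ T = diag(1,1,-1)`, the signs `Im ρ(ξ₀) < 0`, `Im ρ(ξ) < 0` (`ρ ∈ Φ`), definiteness of `H` off
  the place of `τ` (`hpos`) and ★ `IsExtAdapted τ j Φ` — with these conventions `E_δ(Jv, v) < 0`, i.e. `J` lies in the
  `X⁻` half (`-J ∈ C0 δ`);
* §7 the `σ`-evaluations `embOf σ : ℝ ⊗_ℚ M →ₐ[ℝ] ℂ` for ALL `σ : M →+* ℂ` (`realEmb_eq_embOf` on `Φ`, `embOf σ̄ = conj ∘ embOf σ`,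
  `embOf_iPhiVal_of_mem/_of_not_mem = ±i`, `sMat_map_embOf_*`, the block images (E1)/(E2)
  `coe_blockGL_iPhi_sPhi_map_embOf_of_mem/_of_not_mem`) — the complexification bookkeeping for the eigen-decomposition
  of `J_{β,Φ}` (period map).

This is `h_W(i)` of [Deligne1979ShimuraVarieties, 2.3.10]: multiplication by `i` on `W₀ ⊗ ℝ` and on the positive
plane `ℓ_z^⊥ ⊂ V ⊗_{M,ρ} ℂ`, by `-i` on the negative line `ℓ_z` (at the `ρ ∈ Φ` over `τ`), by `i` at the other `ρ ∈ Φ`.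

NOT IN THIS FILE (said here so that no consumer waits on it): (a) the equivariance `J(γ • z) = conjJ g_ℝ (J z)` for
`γ ∈ G(ℚ)` acting on `𝔹²` through the frame (sibling `UnitaryAuxiliaryComplexStructureEquivariance`); (b) (Δ2 of the T3
receptacle plan) the point map to the Siegel Shimura set.
-/

set_option autoImplicit false

noncomputable section

open Matrix NumberField
open scoped TensorProduct ComplexConjugate Classical

namespace Literature.AlgebraicGeometry.ShimuraVarieties

namespace UnitaryCanonicalModel

namespace Aux

open Literature.AlgebraicGeometry.ModuliOfAbelianVarieties
open Literature.AlgebraicGeometry.Motives (CMType)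
open Literature.NumberTheory.ComplexMultiplication (CMTypeLattice.cmEmbedding CMTypeLattice.cmEmbedding_apply
  CMTypeLattice.finrank_real_pi CMTypeLattice.span_range_cmEmbedding_eq_top)
open Literature.Geometry.ComplexHyperbolic
open Literature.NumberTheory.Automorphic (formCongr formCongr_star)

/-! ### §1. Real points: `ℝ ⊗_ℚ M ≃ ℂ^Φ` -/

section RealPoints

variable (M : Type) [Field M] [NumberField M] (Φ : CMType M)

/-- **Shimura's `v` on real points**: the `ℝ`-algebra map `ℝ ⊗_ℚ M → ℂ^Φ`, `r ⊗ x ↦ (r·ρ(x))_{ρ ∈ Φ}`.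
[cite: Shimura1998, §6.2 Thm. 4, p. 44] [cite: Deligne1979ShimuraVarieties, Prop. 2.3.10 (PDF p. 32)] -/
def realPi : ℝ ⊗[ℚ] M →ₐ[ℝ] (Φ.1 → ℂ) :=
  Algebra.TensorProduct.lift (Algebra.ofId ℝ (Φ.1 → ℂ)) (CMTypeLattice.cmEmbedding Φ).toRatAlgHom
    (fun _ _ => Commute.all _ _)

/-- `v(r ⊗ x)_ρ = r·ρ(x)`. [cite: Shimura1998, §6.2 Thm. 4, p. 44] -/
@[simp] theorem realPi_tmul (r : ℝ) (x : M) (ρ : Φ.1) : realPi M Φ (r ⊗ₜ x) ρ = (r : ℂ) * ρ.1 x := by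
  rw [realPi, Algebra.TensorProduct.lift_tmul, Pi.mul_apply, Algebra.ofId_apply, Pi.algebraMap_apply,
    Complex.coe_algebraMap, RingHom.toRatAlgHom_apply, CMTypeLattice.cmEmbedding_apply]

/-- `v(1 ⊗ x) = (ρ(x))_ρ` (the restriction of `realPi` to `M` is ★ `cmEmbedding Φ`). [cite: Shimura1998, §6.2 Thm. 4, p. 44] -/
theorem realPi_one_tmul (x : M) : realPi M Φ (1 ⊗ₜ x) = CMTypeLattice.cmEmbedding Φ x := by
  funext ρ
  rw [realPi_tmul, Complex.ofReal_one, one_mul, CMTypeLattice.cmEmbedding_apply]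

/-- `realPi` is surjective: the `v(x)`, `x ∈ M`, span `ℂ^Φ` over `ℝ` (★ `span_range_cmEmbedding_eq_top`).
[cite: Shimura1998, §6.2, proof of Thm. 3, p. 42] -/
theorem realPi_surjective : Function.Surjective (realPi M Φ) := by
  rw [← AlgHom.coe_toLinearMap, ← LinearMap.range_eq_top, eq_top_iff,
    ← CMTypeLattice.span_range_cmEmbedding_eq_top Φ, Submodule.span_le]
  rintro _ ⟨x, rfl⟩
  exact ⟨(1 : ℝ) ⊗ₜ x, realPi_one_tmul M Φ x⟩

/-- `dim_ℝ (ℝ ⊗_ℚ M) = dim_ℝ ℂ^Φ = [M:ℚ]`. [cite: Shimura1998, §6.1 Thm. 2, p. 41] -/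
theorem finrank_real_tensor_eq : Module.finrank ℝ (ℝ ⊗[ℚ] M) = Module.finrank ℝ (Φ.1 → ℂ) := by
  rw [Module.finrank_baseChange, CMTypeLattice.finrank_real_pi]

/-- `realPi` is bijective (surjective between `ℝ`-spaces of the same finite dimension).
[cite: Shimura1998, §6.2, proof of Thm. 3, p. 42] -/
theorem realPi_bijective : Function.Bijective (realPi M Φ) := by
  refine ⟨?_, realPi_surjective M Φ⟩
  have h := (LinearMap.injective_iff_surjective_of_finrank_eq_finrank (f := (realPi M Φ).toLinearMap)
    (finrank_real_tensor_eq M Φ)).2 (realPi_surjective M Φ)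
  exact h

/-- **`ℝ ⊗_ℚ M ≃ₐ[ℝ] ℂ^Φ`**. [cite: Shimura1998, §6.2 Thm. 4, p. 44] [cite: Deligne1979ShimuraVarieties, Prop. 2.3.10 (PDF p. 32)] -/
def realPiEquiv : ℝ ⊗[ℚ] M ≃ₐ[ℝ] (Φ.1 → ℂ) :=
  AlgEquiv.ofBijective (realPi M Φ) (realPi_bijective M Φ)

/-- `realPiEquiv = realPi` on elements. [cite: Shimura1998, §6.2 Thm. 4, p. 44] -/
@[simp] theorem realPiEquiv_apply (x : ℝ ⊗[ℚ] M) : realPiEquiv M Φ x = realPi M Φ x := rfl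

/-- `realPi (realPiEquiv⁻¹ y) = y`. [cite: Shimura1998, §6.2 Thm. 4, p. 44] -/
@[simp] theorem realPi_symm_apply (y : Φ.1 → ℂ) : realPi M Φ ((realPiEquiv M Φ).symm y) = y :=
  (realPiEquiv M Φ).apply_symm_apply y

/-- The `ρ`-evaluation `ℝ ⊗_ℚ M →ₐ[ℝ] ℂ`, `r ⊗ x ↦ r·ρ(x)` (`ρ ∈ Φ`). [cite: Shimura1998, §6.2 Thm. 4, p. 44] -/
def realEmb (ρ : Φ.1) : ℝ ⊗[ℚ] M →ₐ[ℝ] ℂ :=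
  (Pi.evalAlgHom ℝ (fun _ : Φ.1 => ℂ) ρ).comp (realPi M Φ)

/-- `realEmb ρ x = (realPi x)_ρ`. [cite: Shimura1998, §6.2 Thm. 4, p. 44] -/
@[simp] theorem realEmb_apply (ρ : Φ.1) (x : ℝ ⊗[ℚ] M) : realEmb M Φ ρ x = realPi M Φ x ρ := rfl

/-- `realEmb ρ (r ⊗ x) = r·ρ(x)`. [cite: Shimura1998, §6.2 Thm. 4, p. 44] -/
theorem realEmb_tmul (ρ : Φ.1) (r : ℝ) (x : M) : realEmb M Φ ρ (r ⊗ₜ x) = (r : ℂ) * ρ.1 x :=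
  realPi_tmul M Φ r x ρ

/-- **Joint injectivity of the `realEmb ρ`**: an element of `ℝ ⊗_ℚ M` is determined by its `Φ`-components.
[cite: Shimura1998, §6.2, proof of Thm. 3, p. 42] -/
theorem eq_of_realEmb_eq {x y : ℝ ⊗[ℚ] M} (h : ∀ ρ : Φ.1, realEmb M Φ ρ x = realEmb M Φ ρ y) : x = y :=
  (realPi_bijective M Φ).1 (funext h)

/-- Matrices over `ℝ ⊗_ℚ M` are determined by their images under the `realEmb ρ`, `ρ ∈ Φ`. [cite: Shimura1998, §6.2 Thm. 4, p. 44] -/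
theorem matrix_eq_of_realEmb_eq {m n : Type} {A B : Matrix m n (ℝ ⊗[ℚ] M)}
    (h : ∀ ρ : Φ.1, A.map (realEmb M Φ ρ) = B.map (realEmb M Φ ρ)) : A = B := by
  ext a b
  exact eq_of_realEmb_eq M Φ fun ρ => by
    have := congr_fun (congr_fun (h ρ) a) b
    simpa only [Matrix.map_apply] using this

/-- `realEmb ρ (1 ⊗ x) = ρ(x)`: on `M ⊂ ℝ ⊗_ℚ M` (★ `includeRight`) the evaluation is the embedding `ρ`.
[cite: Shimura1998, §6.2 Thm. 4, p. 44] -/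
theorem realEmb_includeRight (ρ : Φ.1) (x : M) :
    realEmb M Φ ρ ((Algebra.TensorProduct.includeRight : M →ₐ[ℚ] ℝ ⊗[ℚ] M) x) = ρ.1 x := by
  rw [Algebra.TensorProduct.includeRight_apply, realEmb_tmul, Complex.ofReal_one, one_mul]

/-- A matrix with entries in `M`, base-changed to `ℝ ⊗_ℚ M` and evaluated at `ρ`, is its image under `ρ`. [cite: Shimura1998, §6.2 Thm. 4, p. 44] -/
theorem map_includeRight_map_realEmb {m n : Type} (ρ : Φ.1) (A : Matrix m n M) :
    (A.map (Algebra.TensorProduct.includeRight : M →ₐ[ℚ] ℝ ⊗[ℚ] M)).map (realEmb M Φ ρ) = A.map ρ.1 := by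
  ext a b
  simp only [Matrix.map_apply, realEmb_includeRight]

/-! #### Complex conjugation -/

variable [IsCMField M]

/-- **`v ∘ (1 ⊗ c) = conj ∘ v` componentwise** (every `ρ ∈ Φ` intertwines `c` with complex conjugation, Mathlib
★ `IsCMField.complexEmbedding_complexConj`). [cite: Deligne1979ShimuraVarieties, 2.3.9 (PDF p. 32)] -/
theorem realPi_conjR (x : ℝ ⊗[ℚ] M) (ρ : Φ.1) : realPi M Φ (conjR M ℝ x) ρ = conj (realPi M Φ x ρ) := by
  induction x using TensorProduct.induction_on with
  | zero => simp
  | tmul r m =>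
      rw [conjR_tmul, realPi_tmul, realPi_tmul, map_mul, Complex.conj_ofReal,
        IsCMField.complexEmbedding_complexConj M]
  | add x y hx hy => simp only [map_add, Pi.add_apply, hx, hy]

/-- `realEmb ρ ∘ (1 ⊗ c) = conj ∘ realEmb ρ`. [cite: Deligne1979ShimuraVarieties, 2.3.9 (PDF p. 32)] -/
theorem realEmb_conjR (ρ : Φ.1) (x : ℝ ⊗[ℚ] M) : realEmb M Φ ρ (conjR M ℝ x) = conj (realEmb M Φ ρ x) :=
  realPi_conjR M Φ x ρ

/-- `(A.map (1 ⊗ c)).map (realEmb ρ) = conj ∘ (A.map (realEmb ρ))` entrywise. [cite: Shimura1998, §6.2 Thm. 4, p. 44] -/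
theorem map_conjR_map_realEmb {m n : Type} (ρ : Φ.1) (A : Matrix m n (ℝ ⊗[ℚ] M)) :
    (A.map (conjR M ℝ)).map (realEmb M Φ ρ) = (A.map (realEmb M Φ ρ)).map (starRingEnd ℂ) := by
  ext a b
  simp only [Matrix.map_apply, realEmb_conjR]

end RealPoints

/-! ### §2. The element `iPhi` (all `Φ`-components equal to `i`) -/

section IPhi

variable (M : Type) [Field M] [NumberField M] (Φ : CMType M)

/-- The element of `ℝ ⊗_ℚ M` whose `Φ`-components are all `i` (the value `h(i)|_{W₀}` of Deligne's `h`, i.e. the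
complex structure on `M ⊗ ℝ ≅ ℂ^Φ` defined by the CM type `Φ`). [cite: Deligne1979ShimuraVarieties, Prop. 2.3.10 (PDF p. 32)]
[cite: Shimura1998, §6.2 Thm. 4, p. 44] -/
def iPhiVal : ℝ ⊗[ℚ] M :=
  (realPiEquiv M Φ).symm fun _ => Complex.I

/-- `realEmb ρ iPhi = i`. [cite: Deligne1979ShimuraVarieties, Prop. 2.3.10 (PDF p. 32)] -/
@[simp] theorem realEmb_iPhiVal (ρ : Φ.1) : realEmb M Φ ρ (iPhiVal M Φ) = Complex.I := by
  rw [realEmb_apply, iPhiVal, realPi_symm_apply]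

/-- `iPhi · iPhi = -1`. [cite: Deligne1979ShimuraVarieties, Prop. 2.3.10 (PDF p. 32)] -/
theorem iPhiVal_mul_self : iPhiVal M Φ * iPhiVal M Φ = -1 :=
  eq_of_realEmb_eq M Φ fun ρ => by rw [map_mul, realEmb_iPhiVal, Complex.I_mul_I, map_neg, map_one]

/-- **`iPhi ∈ (ℝ ⊗_ℚ M)ˣ`** (inverse `-iPhi`). [cite: Deligne1979ShimuraVarieties, Prop. 2.3.10 (PDF p. 32)] -/
def iPhi : (ℝ ⊗[ℚ] M)ˣ where
  val := iPhiVal M Φ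
  inv := -iPhiVal M Φ
  val_inv := by rw [mul_neg, iPhiVal_mul_self, neg_neg]
  inv_val := by rw [neg_mul, iPhiVal_mul_self, neg_neg]

/-- `(iPhi : ℝ ⊗_ℚ M) = iPhiVal`. [cite: Deligne1979ShimuraVarieties, Prop. 2.3.10 (PDF p. 32)] -/
@[simp] theorem coe_iPhi : ((iPhi M Φ : (ℝ ⊗[ℚ] M)ˣ) : ℝ ⊗[ℚ] M) = iPhiVal M Φ := rfl

/-- `iPhi² = -1` in `(ℝ ⊗_ℚ M)ˣ`. [cite: Deligne1979ShimuraVarieties, Prop. 2.3.10 (PDF p. 32)] -/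
theorem iPhi_mul_self : iPhi M Φ * iPhi M Φ = -1 :=
  Units.ext (by rw [Units.val_mul, coe_iPhi, iPhiVal_mul_self, Units.val_neg, Units.val_one])

variable [IsCMField M]

/-- `(1 ⊗ c)(iPhi) = -iPhi` (all components `conj i = -i`). [cite: Deligne1979ShimuraVarieties, 2.3.9–2.3.10 (PDF p. 32)] -/
theorem conjR_iPhiVal : conjR M ℝ (iPhiVal M Φ) = -iPhiVal M Φ :=
  eq_of_realEmb_eq M Φ fun ρ => by rw [realEmb_conjR, realEmb_iPhiVal, Complex.conj_I, map_neg, realEmb_iPhiVal]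

/-- **The torus condition with multiplier `1`: `c(iPhi)·iPhi = 1`** (the hypothesis `ht` of ★ `isMultiplier_auxRep`
at `ν = 1`). [cite: Deligne1979ShimuraVarieties, Prop. 2.3.10 (PDF p. 32)] -/
theorem conjR_iPhi_mul_iPhi :
    conjR M ℝ (iPhi M Φ : ℝ ⊗[ℚ] M) * (iPhi M Φ : ℝ ⊗[ℚ] M) = algebraMap ℝ (ℝ ⊗[ℚ] M) ((1 : ℝˣ) : ℝ) := by
  rw [coe_iPhi, conjR_iPhiVal, neg_mul, iPhiVal_mul_self, neg_neg, Units.val_one, map_one]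

end IPhi

/-! ### §3. The reflection in a negative line -/

section Reflection

/-- `q(w) = w̄ᵀ J w` (`= Q(w)`, ★ `BallModel.form_eq_Q`). [cite: Jacobowitz1990, Ch. 2 §1 (p. 40)] -/
def formJ (w : Fin 3 → ℂ) : ℂ := star w ⬝ᵥ (BallModel.J *ᵥ w)

/-- `q(w) = Q(w)` is real. [cite: Jacobowitz1990, Ch. 2 §1 (p. 40)] -/
theorem formJ_eq (w : Fin 3 → ℂ) : formJ w = ((BallModel.Q w : ℝ) : ℂ) := BallModel.form_eq_Q w

/-- `conj q(w) = q(w)`. [cite: Jacobowitz1990, Ch. 2 §1 (p. 40)] -/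
theorem conj_formJ (w : Fin 3 → ℂ) : conj (formJ w) = formJ w := by
  rw [formJ_eq, Complex.conj_ofReal]

/-- `q(lift z) ≠ 0` for a point `z` of the ball (★ `BallModel.Q_lift`: it is `< 0`). [cite: Jacobowitz1990, Ch. 2 §1 (p. 40)] -/
theorem formJ_lift_ne_zero (z : BallModel.Ball) : formJ (BallModel.lift z) ≠ 0 := by
  rw [formJ_eq, Ne, Complex.ofReal_eq_zero]
  exact (BallModel.Q_lift z).ne

/-- **The `J`-orthogonal projection onto the line `ℂw`**: `P_w = w·(w̄ᵀJ)/(w̄ᵀJw)`. [cite: Deligne1979ShimuraVarieties, Prop. 2.3.10 (PDF p. 32)] -/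
def projJ (w : Fin 3 → ℂ) : Matrix (Fin 3) (Fin 3) ℂ :=
  (formJ w)⁻¹ • Matrix.vecMulVec w (star w ᵥ* BallModel.J)

/-- **The `J`-reflection in the line `ℂw`**: `r_w = 1 - 2P_w` (`-1` on `ℂw`, `+1` on its `J`-orthogonal).
[cite: Deligne1979ShimuraVarieties, Prop. 2.3.10 (PDF p. 32)] -/
def reflJ (w : Fin 3 → ℂ) : Matrix (Fin 3) (Fin 3) ℂ :=
  1 - (2 : ℂ) • projJ w

variable {w : Fin 3 → ℂ}

/-- `P_w² = P_w`. [cite: Deligne1979ShimuraVarieties, Prop. 2.3.10 (PDF p. 32)] -/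
theorem projJ_mul_projJ (hw : formJ w ≠ 0) : projJ w * projJ w = projJ w := by
  rw [projJ, Matrix.smul_mul, Matrix.mul_smul, Matrix.vecMulVec_mul_vecMulVec, ← Matrix.dotProduct_mulVec,
    Matrix.vecMulVec_smul, smul_smul, smul_smul]
  change ((formJ w)⁻¹ * (formJ w)⁻¹ * formJ w) • _ = _
  rw [inv_mul_cancel_right₀ hw]

/-- `r_w² = 1`. [cite: Jacobowitz1990, Ch. 2 §1 (p. 40)] -/
theorem reflJ_mul_reflJ (hw : formJ w ≠ 0) : reflJ w * reflJ w = 1 := by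
  have hPP := projJ_mul_projJ hw
  simp only [reflJ, sub_mul, mul_sub, Matrix.one_mul, Matrix.mul_one, Matrix.smul_mul, Matrix.mul_smul, hPP,
    smul_smul]
  module

/-- `P_wᴴ J = J P_w` (`P_w` is `J`-self-adjoint). [cite: Deligne1979ShimuraVarieties, Prop. 2.3.10 (PDF p. 32)] -/
theorem conjTranspose_projJ_mul_J : (projJ w)ᴴ * BallModel.J = BallModel.J * projJ w := by
  have hJ : (BallModel.J)ᴴ = BallModel.J := by
    rw [BallModel.J, Matrix.conjTranspose, Matrix.diagonal_transpose, Matrix.diagonal_map (star_zero ℂ)]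
    congr 1
    funext i
    fin_cases i <;> simp
  rw [projJ, Matrix.conjTranspose_smul, Matrix.conjTranspose_vecMulVec, Matrix.star_vecMul, star_star, hJ,
    Matrix.smul_mul, Matrix.mul_smul, Matrix.vecMulVec_mul, Matrix.mul_vecMulVec]
  congr 1
  rw [star_inv₀, Complex.star_def, conj_formJ]

/-- `r_wᴴ J = J r_w` (`r_w` is `J`-self-adjoint). [cite: Deligne1979ShimuraVarieties, Prop. 2.3.10 (PDF p. 32)] -/
theorem conjTranspose_reflJ_mul_J : (reflJ w)ᴴ * BallModel.J = BallModel.J * reflJ w := by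
  have h2 : star (2 : ℂ) = 2 := by
    rw [Complex.star_def, ← Complex.ofReal_ofNat, Complex.conj_ofReal]
  rw [reflJ, Matrix.conjTranspose_sub, Matrix.conjTranspose_one, Matrix.conjTranspose_smul, h2, Matrix.sub_mul,
    Matrix.one_mul, Matrix.smul_mul, conjTranspose_projJ_mul_J, Matrix.mul_sub, Matrix.mul_one, Matrix.mul_smul]

/-- **`r_wᴴ J r_w = J`**: the reflection is `J`-unitary. [cite: Jacobowitz1990, Ch. 2 §1 (p. 40)] -/
theorem conjTranspose_reflJ_mul_J_mul_reflJ (hw : formJ w ≠ 0) :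
    (reflJ w)ᴴ * BallModel.J * reflJ w = BallModel.J := by
  rw [conjTranspose_reflJ_mul_J, Matrix.mul_assoc, reflJ_mul_reflJ hw, Matrix.mul_one]

/-- Scaling the vector does not change the projection: `P_{c w} = P_w` for `c ≠ 0`. [cite: Deligne1979ShimuraVarieties, Prop. 2.3.10 (PDF p. 32)] -/
theorem projJ_smul {c : ℂ} (hc : c ≠ 0) (w : Fin 3 → ℂ) : projJ (c • w) = projJ w := by
  have hq : formJ (c • w) = (conj c * c) * formJ w := by
    rw [formJ, formJ, star_smul, Matrix.mulVec_smul, smul_dotProduct, dotProduct_smul, smul_smul, smul_eq_mul,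
      Complex.star_def]
  have hc' : conj c ≠ 0 := (map_ne_zero _).2 hc
  by_cases hw : formJ w = 0
  · rw [projJ, projJ, hq, hw, mul_zero, _root_.inv_zero, zero_smul, zero_smul]
  rw [projJ, projJ, hq, star_smul, Matrix.smul_vecMul, Complex.star_def, Matrix.smul_vecMulVec,
    Matrix.vecMulVec_smul, smul_smul, smul_smul]
  congr 1
  field_simp

/-- `r_{c w} = r_w` for `c ≠ 0`. [cite: Deligne1979ShimuraVarieties, Prop. 2.3.10 (PDF p. 32)] -/
theorem reflJ_smul {c : ℂ} (hc : c ≠ 0) (w : Fin 3 → ℂ) : reflJ (c • w) = reflJ w := by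
  rw [reflJ, reflJ, projJ_smul hc]

end Reflection

/-! ### §3′. Transport to the frame of `H^τ` -/

section Frame

variable {L : Type} [Field L] (H : Matrix (Fin 3) (Fin 3) L) (τ : L →+* ℂ) (T : GL (Fin 3) ℂ)

/-- **The reflection in the frame of `H^τ`**: `s = T·r_w·T⁻¹` (for `Tᴴ H^τ T = J`, `T` carries `J`-negative vectors
to `H^τ`-negative vectors, and `s` is the `H^τ`-reflection in the line `ℂ·Tw`). [cite: Deligne1979ShimuraVarieties, Prop. 2.3.10 (PDF p. 32)] -/
def reflFrame (w : Fin 3 → ℂ) : Matrix (Fin 3) (Fin 3) ℂ :=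
  (T : Matrix (Fin 3) (Fin 3) ℂ) * reflJ w * ((T⁻¹ : GL (Fin 3) ℂ) : Matrix (Fin 3) (Fin 3) ℂ)

variable {w : Fin 3 → ℂ}

/-- `(T r T⁻¹)² = 1` when `r² = 1`. [folklore] -/
private theorem conj_mul_conj_eq_one {Tm Ti r : Matrix (Fin 3) (Fin 3) ℂ} (h1 : Ti * Tm = 1) (h2 : Tm * Ti = 1)
    (hr : r * r = 1) : Tm * r * Ti * (Tm * r * Ti) = 1 := by
  calc Tm * r * Ti * (Tm * r * Ti) = Tm * (r * ((Ti * Tm) * r)) * Ti := by simp only [Matrix.mul_assoc]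
    _ = 1 := by rw [h1, Matrix.one_mul, hr, Matrix.mul_one, h2]

/-- `(T r T⁻¹)ᴴ K (T r T⁻¹) = K` when `Tᴴ K T = J'` and `rᴴ J' r = J'`. [folklore] -/
private theorem conjTranspose_conj_mul_mul {Tm Ti r K J' : Matrix (Fin 3) (Fin 3) ℂ} (h2 : Tm * Ti = 1)
    (hT : Tmᴴ * K * Tm = J') (hr : rᴴ * J' * r = J') : (Tm * r * Ti)ᴴ * K * (Tm * r * Ti) = K := by
  have hK : K = Tiᴴ * J' * Ti := by
    calc K = (Tm * Ti)ᴴ * K * (Tm * Ti) := by rw [h2, Matrix.conjTranspose_one, Matrix.one_mul, Matrix.mul_one]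
      _ = Tiᴴ * (Tmᴴ * K * Tm) * Ti := by rw [Matrix.conjTranspose_mul]; simp only [Matrix.mul_assoc]
      _ = Tiᴴ * J' * Ti := by rw [hT]
  calc (Tm * r * Ti)ᴴ * K * (Tm * r * Ti) = Tiᴴ * (rᴴ * (Tmᴴ * K * Tm) * r) * Ti := by
        rw [Matrix.conjTranspose_mul, Matrix.conjTranspose_mul]; simp only [Matrix.mul_assoc]
    _ = K := by rw [hT, hr, ← hK]

/-- `s² = 1`. [cite: Jacobowitz1990, Ch. 2 §1 (p. 40)] -/
theorem reflFrame_mul_reflFrame (hw : formJ w ≠ 0) : reflFrame T w * reflFrame T w = 1 :=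
  conj_mul_conj_eq_one (by rw [← Units.val_mul, inv_mul_cancel, Units.val_one])
    (by rw [← Units.val_mul, mul_inv_cancel, Units.val_one]) (reflJ_mul_reflJ hw)

/-- **`sᴴ H^τ s = H^τ`** when `Tᴴ H^τ T = J`: the transported reflection is `H^τ`-unitary. [cite: Deligne1979ShimuraVarieties, Prop. 2.3.10 (PDF p. 32)] -/
theorem conjTranspose_reflFrame_mul_mul
    (hT : (T : Matrix (Fin 3) (Fin 3) ℂ)ᴴ * H.map τ * (T : Matrix (Fin 3) (Fin 3) ℂ) = BallModel.J)
    (hw : formJ w ≠ 0) : (reflFrame T w)ᴴ * H.map τ * reflFrame T w = H.map τ :=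
  conjTranspose_conj_mul_mul (by rw [← Units.val_mul, mul_inv_cancel, Units.val_one]) hT
    (conjTranspose_reflJ_mul_J_mul_reflJ hw)

end Frame

/-! ### §4. The element `sPhi ∈ GL₃(ℝ ⊗_ℚ M)` -/

section SPhi

variable {L : Type} [Field L] (M : Type) [Field M] [NumberField M] (j : L →+* M) (Φ : CMType M)
  (τ : L →+* ℂ) (T : GL (Fin 3) ℂ)

/-- The `Φ`-components of `s_z`: the transported reflection `reflFrame T w` at the `ρ ∈ Φ` lying over `τ`
(`ρ ∘ j = τ`), the identity at the other `ρ ∈ Φ`. [cite: Deligne1979ShimuraVarieties, Prop. 2.3.10 (PDF p. 32)] -/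
def sComp (w : Fin 3 → ℂ) (ρ : Φ.1) : Matrix (Fin 3) (Fin 3) ℂ :=
  if ρ.1.comp j = τ then reflFrame T w else 1

variable {M j Φ τ T} in
omit [NumberField M] in
/-- `sComp` over `τ`. [cite: Deligne1979ShimuraVarieties, Prop. 2.3.10 (PDF p. 32)] -/
theorem sComp_of_eq (w : Fin 3 → ℂ) {ρ : Φ.1} (h : ρ.1.comp j = τ) : sComp M j Φ τ T w ρ = reflFrame T w :=
  if_pos h

variable {M j Φ τ T} in
omit [NumberField M] in
/-- `sComp` off `τ`. [cite: Deligne1979ShimuraVarieties, Prop. 2.3.10 (PDF p. 32)] -/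
theorem sComp_of_ne (w : Fin 3 → ℂ) {ρ : Φ.1} (h : ρ.1.comp j ≠ τ) : sComp M j Φ τ T w ρ = 1 :=
  if_neg h

/-- **The matrix `s_w ∈ M₃(ℝ ⊗_ℚ M)` with prescribed `Φ`-components** (pulled back through ★ `realPiEquiv`).
[cite: Deligne1979ShimuraVarieties, Prop. 2.3.10 (PDF p. 32)] -/
def sMat (w : Fin 3 → ℂ) : Matrix (Fin 3) (Fin 3) (ℝ ⊗[ℚ] M) :=
  Matrix.of fun a b => (realPiEquiv M Φ).symm fun ρ => sComp M j Φ τ T w ρ a b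

/-- The `ρ`-component of `sMat w` is `sComp w ρ`. [cite: Deligne1979ShimuraVarieties, Prop. 2.3.10 (PDF p. 32)] -/
@[simp] theorem sMat_map_realEmb (w : Fin 3 → ℂ) (ρ : Φ.1) :
    (sMat M j Φ τ T w).map (realEmb M Φ ρ) = sComp M j Φ τ T w ρ := by
  ext a b
  rw [Matrix.map_apply, sMat, Matrix.of_apply, realEmb_apply, realPi_symm_apply]

variable {w : Fin 3 → ℂ}

omit [NumberField M] in
/-- `sComp w ρ² = 1`. [cite: Jacobowitz1990, Ch. 2 §1 (p. 40)] -/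
theorem sComp_mul_sComp (hw : formJ w ≠ 0) (ρ : Φ.1) : sComp M j Φ τ T w ρ * sComp M j Φ τ T w ρ = 1 := by
  by_cases h : ρ.1.comp j = τ
  · rw [sComp_of_eq w h, reflFrame_mul_reflFrame T hw]
  · rw [sComp_of_ne w h, Matrix.mul_one]

/-- `sMat w² = 1`. [cite: Jacobowitz1990, Ch. 2 §1 (p. 40)] -/
theorem sMat_mul_sMat (hw : formJ w ≠ 0) : sMat M j Φ τ T w * sMat M j Φ τ T w = 1 :=
  matrix_eq_of_realEmb_eq M Φ fun ρ => by
    rw [Matrix.map_mul, sMat_map_realEmb, sComp_mul_sComp M j Φ τ T hw, Matrix.map_one _ (map_zero _) (map_one _)]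

/-- **`s_z ∈ GL₃(ℝ ⊗_ℚ M)`** at the negative vector `w = lift z = (z₀, z₁, 1)` of the point `z ∈ 𝔹²` (an involution:
inverse = itself). [cite: Deligne1979ShimuraVarieties, Prop. 2.3.10 (PDF p. 32)] -/
def sPhi (z : BallModel.Ball) : GL (Fin 3) (ℝ ⊗[ℚ] M) where
  val := sMat M j Φ τ T (BallModel.lift z)
  inv := sMat M j Φ τ T (BallModel.lift z)
  val_inv := sMat_mul_sMat M j Φ τ T (formJ_lift_ne_zero z)
  inv_val := sMat_mul_sMat M j Φ τ T (formJ_lift_ne_zero z)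

/-- Underlying matrix of `sPhi`. [cite: Deligne1979ShimuraVarieties, Prop. 2.3.10 (PDF p. 32)] -/
@[simp] theorem coe_sPhi (z : BallModel.Ball) :
    ((sPhi M j Φ τ T z : GL (Fin 3) (ℝ ⊗[ℚ] M)) : Matrix (Fin 3) (Fin 3) (ℝ ⊗[ℚ] M)) = sMat M j Φ τ T (BallModel.lift z) :=
  rfl

/-- `sPhi z² = 1`. [cite: Deligne1979ShimuraVarieties, Prop. 2.3.10 (PDF p. 32)] -/
theorem sPhi_mul_self (z : BallModel.Ball) : sPhi M j Φ τ T z * sPhi M j Φ τ T z = 1 :=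
  Units.ext (sMat_mul_sMat M j Φ τ T (formJ_lift_ne_zero z))

/-- `((A.map conj)ᵀ = Aᴴ` for complex matrices. [folklore] -/
private theorem transpose_map_starRingEnd {m n : Type} (A : Matrix m n ℂ) : (A.map (starRingEnd ℂ))ᵀ = Aᴴ := by
  ext a b
  rfl

variable [IsCMField M]

/-- **`s_z` is unitary for `H^j` over `ℝ ⊗_ℚ M`**: `ᵗc(s_z)·H^j·s_z = H^j` (the hypothesis `hX` of ★ `isMultiplier_auxRep`),
given the frame `Tᴴ H^τ T = diag(1,1,-1)` (★ `formCongr` spelling).  Componentwise: at `ρ` over `τ` it is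
★ `conjTranspose_reflFrame_mul_mul`, elsewhere `1ᴴ H 1 = H`. [cite: Deligne1979ShimuraVarieties, Prop. 2.3.10 (PDF p. 32)] -/
theorem sPhi_unitary (H : Matrix (Fin 3) (Fin 3) L) (hT : formCongr (starRingEnd ℂ) T (H.map τ) = BallModel.J)
    (z : BallModel.Ball) :
    (((sPhi M j Φ τ T z : GL (Fin 3) (ℝ ⊗[ℚ] M)) : Matrix (Fin 3) (Fin 3) (ℝ ⊗[ℚ] M)).map (conjR M ℝ))ᵀ *
        (H.map j).map (Algebra.TensorProduct.includeRight : M →ₐ[ℚ] ℝ ⊗[ℚ] M) *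
        ((sPhi M j Φ τ T z : GL (Fin 3) (ℝ ⊗[ℚ] M)) : Matrix (Fin 3) (Fin 3) (ℝ ⊗[ℚ] M)) =
      (H.map j).map (Algebra.TensorProduct.includeRight : M →ₐ[ℚ] ℝ ⊗[ℚ] M) := by
  rw [formCongr_star] at hT
  refine matrix_eq_of_realEmb_eq M Φ fun ρ => ?_
  rw [Matrix.map_mul, Matrix.map_mul, Matrix.transpose_map, map_conjR_map_realEmb, coe_sPhi, sMat_map_realEmb,
    transpose_map_starRingEnd, map_includeRight_map_realEmb, Matrix.map_map, ← RingHom.coe_comp]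
  by_cases h : ρ.1.comp j = τ
  · rw [sComp_of_eq _ h, h]
    exact conjTranspose_reflFrame_mul_mul H τ T hT (formJ_lift_ne_zero z)
  · rw [sComp_of_ne _ h, Matrix.conjTranspose_one, Matrix.one_mul, Matrix.mul_one]

end SPhi

/-! ### §5. The complex structure `J_{β,Φ}(z) = auxRep ℝ β (iPhi, s_z)` -/

section ComplexStructure

variable {L : Type} [Field L] {M : Type} [Field M] [NumberField M] [IsCMField M] {j : L →+* M}
  {H : Matrix (Fin 3) (Fin 3) L} {ξ₀ ξ : M} {g : ℕ} {δ : Fin g → ℕ}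
  (F : SymplecticFrame M j H ξ₀ ξ g δ) (τ : L →+* ℂ) (Φ : CMType M) (T : GL (Fin 3) ℂ) (z : BallModel.Ball)

/-- **Deligne's `h_W(i)` as an element of `GL_{g⊕g}(ℝ)`**: `auxRep ℝ β (iPhi, s_z)` — the block matrix `diag(i, i·s_z)` on
`(W₀ ⊕ V_M) ⊗ ℝ` read in the symplectic frame `β`. [cite: Deligne1979ShimuraVarieties, Prop. 2.3.10 (PDF p. 32)]
[cite: Milne2005ShimuraVarieties, §8 p. 81] -/
def auxComplexStructureGL : GL (Fin g ⊕ Fin g) ℝ :=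
  auxRep ℝ F (iPhi M Φ, sPhi M j Φ τ T z)

/-- **The complex structure `J_{β,Φ}(z)` on `ℝ^{2g}`** (a real `2g × 2g` matrix; ★ `C0pm δ` lives in this type).
[cite: Deligne1979ShimuraVarieties, Prop. 2.3.10 (PDF p. 32)] [cite: Milne2005ShimuraVarieties, §6 p. 68, §8 p. 81] -/
def auxComplexStructure : Matrix (Fin g ⊕ Fin g) (Fin g ⊕ Fin g) ℝ :=
  ((auxComplexStructureGL F τ Φ T z : GL (Fin g ⊕ Fin g) ℝ) : Matrix (Fin g ⊕ Fin g) (Fin g ⊕ Fin g) ℝ)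

/-- Unfolding. [cite: Deligne1979ShimuraVarieties, Prop. 2.3.10 (PDF p. 32)] -/
theorem auxComplexStructure_def :
    auxComplexStructure F τ Φ T z =
      ((auxRep ℝ F (iPhi M Φ, sPhi M j Φ τ T z) : GL (Fin g ⊕ Fin g) ℝ) : Matrix (Fin g ⊕ Fin g) (Fin g ⊕ Fin g) ℝ) :=
  rfl

/-- `auxRep ℝ β (-1, 1) = -1` (the scalar `-1` of `ℝ ⊗_ℚ M` acts as `-1`). [cite: Deligne1979ShimuraVarieties, Prop. 2.3.10 (PDF p. 32)] -/
theorem coe_auxRep_neg_one_one :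
    ((auxRep ℝ F (-1, 1) : GL (Fin g ⊕ Fin g) ℝ) : Matrix (Fin g ⊕ Fin g) (Fin g ⊕ Fin g) ℝ) = -1 := by
  have h1 : Matrix.fromBlocks (-1 : Matrix (Fin 1) (Fin 1) (ℝ ⊗[ℚ] M)) 0 0 (-1 : Matrix (Fin 3) (Fin 3) (ℝ ⊗[ℚ] M)) = -1 := by
    rw [← Matrix.fromBlocks_one, Matrix.fromBlocks_neg, neg_zero, neg_zero]
  rw [auxRep, MonoidHom.comp_apply, MonoidHom.comp_apply, coe_conjRect, coe_resGL, coe_blockGL, Units.val_neg,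
    Units.val_one, Units.val_one, neg_one_smul, neg_one_smul, h1, map_neg, map_one, Matrix.mul_neg, Matrix.mul_one,
    Matrix.neg_mul, framePR_mul_frameQR]

/-- **`J² = -1`**: `(iPhi, s_z)² = (-1, 1)` and `auxRep ℝ β (-1, 1) = -1`. [cite: Deligne1979ShimuraVarieties, Prop. 2.3.10 (PDF p. 32)]
[cite: Milne2005ShimuraVarieties, §6 p. 68] -/
theorem auxComplexStructure_mul_self :
    auxComplexStructure F τ Φ T z * auxComplexStructure F τ Φ T z = -1 := by
  rw [auxComplexStructure, auxComplexStructureGL, ← Units.val_mul, ← map_mul, Prod.mk_mul_mk, iPhi_mul_self,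
    sPhi_mul_self, coe_auxRep_neg_one_one]

/-- **`J ∈ Sp(E_δ)(ℝ)`** for a frame `Tᴴ H^τ T = diag(1,1,-1)`: ★ `isMultiplier_auxRep` at `ν = 1` with the torus
condition `c(iPhi)·iPhi = 1` (`conjR_iPhi_mul_iPhi`) and the unitarity of `s_z` (`sPhi_unitary`).
[cite: Deligne1979ShimuraVarieties, Prop. 2.3.10 (PDF p. 32)] [cite: Milne2005ShimuraVarieties, §6 p. 67, §8 p. 81] -/
theorem auxComplexStructureGL_mem_symplecticGroupOfForm (hT : formCongr (starRingEnd ℂ) T (H.map τ) = BallModel.J) :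
    auxComplexStructureGL F τ Φ T z ∈ symplecticGroupOfForm (typeFormOver δ ℝ) := by
  change IsMultiplier (typeFormOver δ ℝ) (auxRep ℝ F (iPhi M Φ, sPhi M j Φ τ T z)) 1
  exact isMultiplier_auxRep ℝ F (conjR_iPhi_mul_iPhi M Φ) (sPhi_unitary M j Φ τ T H hT z)

/-- `J ∈ GSp_δ(ℝ)` (★ `gspReal δ`). [cite: Milne2005ShimuraVarieties, §6 p. 67] -/
theorem auxComplexStructureGL_mem_gspReal (hT : formCongr (starRingEnd ℂ) T (H.map τ) = BallModel.J) :
    auxComplexStructureGL F τ Φ T z ∈ gspReal δ :=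
  symplecticGroupOfForm_le_similitudeGroupOfForm _ (auxComplexStructureGL_mem_symplecticGroupOfForm F τ Φ T z hT)

/-- **`ᵗJ·E_δ·J = E_δ`** as real matrices. [cite: Milne2005ShimuraVarieties, §6 p. 67 («ψ(Ju, Jv) = ψ(u, v)»), §8 p. 81] -/
theorem transpose_auxComplexStructure_mul_mul (hT : formCongr (starRingEnd ℂ) T (H.map τ) = BallModel.J) :
    (auxComplexStructure F τ Φ T z)ᵀ * typeFormOver δ ℝ * auxComplexStructure F τ Φ T z = typeFormOver δ ℝ :=
  mem_symplecticGroupOfForm_iff.1 (auxComplexStructureGL_mem_symplecticGroupOfForm F τ Φ T z hT)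

/-- **`J_{β,Φ}(z)` is a symplectic complex structure for `E_δ`** in Lange's sense (★ `SiegelModuli.IsSymplecticComplexStructure`:
`J² = -1`, `ᵗJ E_δ J = E_δ`) — two of the three conditions of ★ `C0pm δ`; the third (definiteness of `ᵗJ E_δ`, of either
sign) is the deferred positivity. [cite: Lange2023AbelianVarietiesComplex, §7.1.2 (p0326)] [cite: Deligne1979ShimuraVarieties, Prop. 2.3.10 (PDF p. 32)] -/
theorem isSymplecticComplexStructure_auxComplexStructure (hT : formCongr (starRingEnd ℂ) T (H.map τ) = BallModel.J) :
    SiegelModuli.IsSymplecticComplexStructure δ (auxComplexStructure F τ Φ T z) :=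
  ⟨auxComplexStructure_mul_self F τ Φ T z, by
    rw [← typeFormOver_real_eq_realTypeForm]; exact transpose_auxComplexStructure_mul_mul F τ Φ T z hT⟩

end ComplexStructure

/-! ### §6. Positivity: `-J_{β,Φ}(z) ∈ C0 δ` and `J_{β,Φ}(z) ∈ C0pm δ`

The Riemann-form computation of [Deligne1979ShimuraVarieties] 2.3.10 / [Milne2005ShimuraVarieties] §8 («ψ(u, h(i)u) definite»):
`E_δ(Jv, v) = ψ_ℝ(Ax, x) = Tr_{ℝ⊗M/ℝ}(ᵗc(Ax)·G·x) = 2 Σ_{ρ∈Φ} [Im ρ(ξ₀)·‖x₀,ρ‖² + Im ρ(ξ)·h_ρ(x_V)]` with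
`h_ρ(v) = vᴴ·H^{ρ∘j}·s_ρ·v ≥ 0` (`> 0` for `v ≠ 0`): at the `ρ` over `τ` because `H^τ·s_z = Nᴴ N` is positive
(`J·r_w = (g⁻¹)ᴴ g⁻¹` for `w = g·(0,0,1)`, `g ∈ U(2,1)`, ★ `exists_smul_x₀_eq`), at the other `ρ ∈ Φ` because `s_ρ = 1`
and `H^{ρ∘j}` is definite (`hpos`; `ρ∘j ≠ τ̄` by ★ `IsExtAdapted` and the CM-type axiom).  With the tree's signs
`Im ρ(ξ) < 0`, `Im ρ(ξ₀) < 0` the form is NEGATIVE definite: `-J ∈ C0 δ`, `J ∈ C0pm δ`. -/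

open scoped ComplexOrder

section TraceFormula

variable (M : Type) [Field M] [NumberField M] (Φ : CMType M)

/-- A sum over all complex embeddings of `M` is the sum over `Φ` of the summand and its conjugate partner (the partition
`Hom(M,ℂ) = Φ ⊔ Φ̄`; = ★ `CMTypeRiemannForm.sum_embeddings_eq_sum_cmType`, re-derived to keep that module's imports out of
this cone). [cite: Shimura1998, §6.2, proof of Thm. 3, p. 42] -/
private theorem sum_embeddings_eq (f : (M →+* ℂ) → ℂ) :
    ∑ σ : M →+* ℂ, f σ = ∑ ρ : Φ.1, (f ρ.1 + f (ComplexEmbedding.conjugate ρ.1)) := by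
  rw [Finset.sum_add_distrib,
    ← Finset.sum_filter_add_sum_filter_not Finset.univ (fun σ : M →+* ℂ => σ ∈ Φ.1) f]
  congr 1
  · rw [Finset.sum_subtype (Finset.univ.filter fun σ : M →+* ℂ => σ ∈ Φ.1) (p := fun σ => σ ∈ Φ.1)
      (fun σ => by simp)]
  · symm
    refine Finset.sum_bij' (fun (ρ : Φ.1) _ => ComplexEmbedding.conjugate ρ.1)
      (fun σ hσ => ⟨ComplexEmbedding.conjugate σ,
        (Literature.NumberTheory.ComplexMultiplication.CMTypeOps.conjugate_mem_iff_notMem Φ σ).2 (Finset.mem_filter.1 hσ).2⟩) ?_ ?_ ?_ ?_ ?_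
    · intro ρ _
      exact Finset.mem_filter.2 ⟨Finset.mem_univ _, (Φ.2 ρ.1).1 ρ.2⟩
    · intro σ _; exact Finset.mem_univ _
    · intro ρ _; exact Subtype.ext (ComplexEmbedding.involutive_conjugate M ρ.1)
    · intro σ _; exact ComplexEmbedding.involutive_conjugate M σ
    · intro ρ _; rfl

/-- **`Tr_{M/ℚ}(x) = 2 Σ_{ρ∈Φ} Re ρ(x)`** (Mathlib ★ `trace_eq_sum_embeddings` and the partition `Φ ⊔ Φ̄`).
[cite: Shimura1998, §6.2, proof of Thm. 3, p. 44] -/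
theorem algebraMap_trace_eq_two_mul_sum_re (x : M) :
    algebraMap ℚ ℝ (Algebra.trace ℚ M x) = 2 * ∑ ρ : Φ.1, (ρ.1 x).re := by
  apply Complex.ofReal_injective
  have halg : ((algebraMap ℚ ℝ (Algebra.trace ℚ M x) : ℝ) : ℂ) = algebraMap ℚ ℂ (Algebra.trace ℚ M x) := by
    simp [eq_ratCast]
  rw [halg, trace_eq_sum_embeddings ℂ, ← Fintype.sum_equiv RingHom.equivRatAlgHom (fun σ : M →+* ℂ => σ x)
    (fun σ : M →ₐ[ℚ] ℂ => σ x) (fun σ => by simp [RingHom.equivRatAlgHom_apply]), sum_embeddings_eq M Φ,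
    Complex.ofReal_mul, Complex.ofReal_ofNat, Complex.ofReal_sum, Finset.mul_sum]
  refine Finset.sum_congr rfl fun ρ _ => ?_
  rw [ComplexEmbedding.conjugate_coe_eq, Complex.add_conj, Complex.ofReal_mul, Complex.ofReal_ofNat]

/-- **`Tr_{ℝ⊗M/ℝ}(y) = 2 Σ_{ρ∈Φ} Re (realEmb ρ y)`**: the trace of the `ℝ`-algebra `ℝ ⊗_ℚ M ≅ ℂ^Φ` read through the
`Φ`-components (★ `trace_one_tmul` + `algebraMap_trace_eq_two_mul_sum_re`). [cite: Shimura1998, §6.2, proof of Thm. 3, p. 44]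
[cite: Milne2005ShimuraVarieties, §8 p. 81] -/
theorem trace_eq_two_mul_sum_re (y : ℝ ⊗[ℚ] M) :
    Algebra.trace ℝ (ℝ ⊗[ℚ] M) y = 2 * ∑ ρ : Φ.1, (realEmb M Φ ρ y).re := by
  induction y using TensorProduct.induction_on with
  | zero => simp
  | add x y hx hy =>
      simp only [map_add, Complex.add_re, Finset.sum_add_distrib, hx, hy, mul_add]
  | tmul r m =>
      have h1 : (r ⊗ₜ[ℚ] m : ℝ ⊗[ℚ] M) = r • ((1 : ℝ) ⊗ₜ[ℚ] m) := by
        rw [TensorProduct.smul_tmul', smul_eq_mul, mul_one]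
      rw [h1, map_smul, trace_one_tmul, algebraMap_trace_eq_two_mul_sum_re M Φ, smul_eq_mul, Finset.mul_sum,
        Finset.mul_sum, Finset.mul_sum]
      refine Finset.sum_congr rfl fun ρ _ => ?_
      rw [map_smul, realEmb_tmul, Complex.ofReal_one, one_mul, Complex.real_smul, Complex.re_ofReal_mul]
      ring

end TraceFormula

section FormValue

variable (M : Type) [Field M] [NumberField M] [IsCMField M] (Φ : CMType M)

/-- A multiplicative map pulls a scalar out of an entrywise map: `(r·A).map f = f(r)·A.map f`. [folklore] -/
private theorem smul_map {S S' : Type} [CommRing S] [CommRing S'] {F : Type} [FunLike F S S'] [MulHomClass F S S']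
    {m n : Type} (f : F) (r : S) (A : Matrix m n S) : (r • A).map f = f r • A.map f := by
  ext a b
  simp [map_mul]

/-- The `ρ`-component of `ᵗc(x)·G·y ∈ ℝ ⊗_ℚ M` is `x_ρᴴ·G_ρ·y_ρ`. [cite: Milne2005ShimuraVarieties, §8 p. 81] -/
theorem realEmb_dotProduct_conjR_mulVec {m : Type} [Fintype m] (ρ : Φ.1) (G : Matrix m m (ℝ ⊗[ℚ] M))
    (x y : m → ℝ ⊗[ℚ] M) :
    realEmb M Φ ρ (dotProduct (fun i => conjR M ℝ (x i)) (G *ᵥ y)) =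
      star (⇑(realEmb M Φ ρ) ∘ x) ⬝ᵥ (G.map (realEmb M Φ ρ) *ᵥ (⇑(realEmb M Φ ρ) ∘ y)) := by
  rw [← RingHom.coe_coe, RingHom.map_dotProduct]
  congr 1
  · funext i
    simp only [Function.comp_apply, Pi.star_apply, RingHom.coe_coe, realEmb_conjR, Complex.star_def]
  · funext i
    rw [Function.comp_apply, RingHom.map_mulVec]

/-- **The trace form through the `Φ`-components**: `ψ_G(x, y) = Tr_{ℝ⊗M/ℝ}(ᵗc(x)·G·y) = 2 Σ_{ρ∈Φ} Re(x_ρᴴ·G_ρ·y_ρ)`.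
[cite: Milne2005ShimuraVarieties, §8 p. 81] [cite: Shimura1998, §6.2 Thm. 4, p. 44] -/
theorem traceForm_conjR_eq_sum {m : Type} [Fintype m] [DecidableEq m] (G : Matrix m m (ℝ ⊗[ℚ] M))
    (x y : m → ℝ ⊗[ℚ] M) :
    traceForm (conjR M ℝ) G x y =
      2 * ∑ ρ : Φ.1, (star (⇑(realEmb M Φ ρ) ∘ x) ⬝ᵥ (G.map (realEmb M Φ ρ) *ᵥ (⇑(realEmb M Φ ρ) ∘ y))).re := by
  rw [traceForm_apply, trace_eq_two_mul_sum_re M Φ]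
  congr 1
  refine Finset.sum_congr rfl fun ρ _ => ?_
  rw [realEmb_dotProduct_conjR_mulVec]

variable {L : Type} [Field L] (j : L →+* M) (H : Matrix (Fin 3) (Fin 3) L) (ξ₀ ξ : M) (τ : L →+* ℂ)
  (T : GL (Fin 3) ℂ)

omit [IsCMField M] in
/-- `G_ρ = diag(ρ(ξ₀), ρ(ξ)·H^{ρ∘j})`: the `ρ`-image of the Gram data. [cite: Deligne1979ShimuraVarieties, Prop. 2.3.10 (PDF p. 32)] -/
theorem auxGramR_map_realEmb (ρ : Φ.1) :
    (auxGramR M j H ξ₀ ξ ℝ).map (realEmb M Φ ρ) =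
      Matrix.fromBlocks (ρ.1 ξ₀ • (1 : Matrix (Fin 1) (Fin 1) ℂ)) 0 0 (ρ.1 ξ • H.map (ρ.1.comp j)) := by
  rw [auxGramR, map_includeRight_map_realEmb, auxGram, Matrix.fromBlocks_map, smul_map, smul_map,
    Matrix.map_one _ (map_zero _) (map_one _), Matrix.map_zero _ (map_zero _), Matrix.map_zero _ (map_zero _),
    Matrix.map_map, RingHom.coe_comp]

omit [IsCMField M] in
/-- `A_ρ = diag(i, i·s_ρ)`: the `ρ`-image of `diag(iPhi, iPhi·s_z)`. [cite: Deligne1979ShimuraVarieties, Prop. 2.3.10 (PDF p. 32)] -/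
theorem coe_blockGL_iPhi_sPhi_map_realEmb (ρ : Φ.1) (z : BallModel.Ball) :
    (((blockGL (ℝ ⊗[ℚ] M) (iPhi M Φ, sPhi M j Φ τ T z) : GL (Fin 1 ⊕ Fin 3) (ℝ ⊗[ℚ] M)) :
        Matrix (Fin 1 ⊕ Fin 3) (Fin 1 ⊕ Fin 3) (ℝ ⊗[ℚ] M)).map (realEmb M Φ ρ)) =
      Matrix.fromBlocks (Complex.I • (1 : Matrix (Fin 1) (Fin 1) ℂ)) 0 0
        (Complex.I • sComp M j Φ τ T (BallModel.lift z) ρ) := by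
  rw [coe_blockGL, Matrix.fromBlocks_map, smul_map, smul_map, Matrix.map_one _ (map_zero _) (map_one _),
    Matrix.map_zero _ (map_zero _), Matrix.map_zero _ (map_zero _), coe_iPhi, realEmb_iPhiVal, coe_sPhi,
    sMat_map_realEmb]

/-- The `ρ`-summand in coordinates: `(A_ρ x)ᴴ·G_ρ·x = -i·(a·‖x₀‖² + b·(S x_V)ᴴ·H′·x_V)` for `A_ρ = diag(i, i·S)`,
`G_ρ = diag(a, b·H′)`. [cite: Deligne1979ShimuraVarieties, Prop. 2.3.10 (PDF p. 32)] -/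
theorem star_block_mulVec_dotProduct (S H' : Matrix (Fin 3) (Fin 3) ℂ) (a b : ℂ) (x : Fin 1 ⊕ Fin 3 → ℂ) :
    star (Matrix.fromBlocks (Complex.I • (1 : Matrix (Fin 1) (Fin 1) ℂ)) 0 0 (Complex.I • S) *ᵥ x) ⬝ᵥ
        (Matrix.fromBlocks (a • (1 : Matrix (Fin 1) (Fin 1) ℂ)) 0 0 (b • H') *ᵥ x) =
      -Complex.I * (a * (star (x ∘ Sum.inl) ⬝ᵥ (x ∘ Sum.inl)) +
        b * (star (S *ᵥ (x ∘ Sum.inr)) ⬝ᵥ (H' *ᵥ (x ∘ Sum.inr)))) := by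
  have hstar : ∀ (p : Fin 1 → ℂ) (q : Fin 3 → ℂ), star (Sum.elim p q) = Sum.elim (star p) (star q) := by
    intro p q; funext i; cases i <;> rfl
  have hI : star Complex.I = -Complex.I := by rw [Complex.star_def, Complex.conj_I]
  simp only [Matrix.fromBlocks_mulVec, Matrix.zero_mulVec, add_zero, zero_add, Matrix.smul_mulVec, Matrix.one_mulVec,
    hstar, sumElim_dotProduct_sumElim, star_smul, smul_dotProduct, dotProduct_smul, hI, smul_eq_mul]
  ring

/-- Sign bookkeeping: for `Im a < 0`, `Im b < 0` and `n, h ≥ 0` (in `ℂ`), `Re(-i·(a·n + b·h)) = Im a·n + Im b·h ≤ 0`, with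
equality only if `n = h = 0`. [cite: Deligne1979ShimuraVarieties, Prop. 2.3.10 (PDF p. 32)] -/
theorem re_neg_I_mul_nonpos {a b n h : ℂ} (ha : a.im < 0) (hb : b.im < 0) (hn : 0 ≤ n) (hh : 0 ≤ h) :
    (-Complex.I * (a * n + b * h)).re ≤ 0 ∧ ((-Complex.I * (a * n + b * h)).re = 0 → n = 0 ∧ h = 0) := by
  obtain ⟨hnre, hnim⟩ := Complex.nonneg_iff.1 hn
  obtain ⟨hhre, hhim⟩ := Complex.nonneg_iff.1 hh
  have hre : (-Complex.I * (a * n + b * h)).re = a.im * n.re + b.im * h.re := by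
    simp only [Complex.mul_re, Complex.mul_im, Complex.add_im, Complex.neg_re, Complex.neg_im,
      Complex.I_re, Complex.I_im, ← hnim, ← hhim]
    ring
  rw [hre]
  have h1 : a.im * n.re ≤ 0 := by nlinarith
  have h2 : b.im * h.re ≤ 0 := by nlinarith
  refine ⟨by linarith, fun h0 => ?_⟩
  have h1' : a.im * n.re = 0 := le_antisymm h1 (by linarith)
  have h2' : b.im * h.re = 0 := le_antisymm h2 (by linarith)
  have hn0 : n.re = 0 := by
    rcases mul_eq_zero.1 h1' with h | h
    · exact absurd h ha.ne
    · exact h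
  have hh0 : h.re = 0 := by
    rcases mul_eq_zero.1 h2' with h | h
    · exact absurd h hb.ne
    · exact h
  exact ⟨Complex.ext hn0 (by rw [← hnim]; rfl), Complex.ext hh0 (by rw [← hhim]; rfl)⟩

end FormValue

/-! #### Positivity of `H^τ·s_z` (the `ρ` over `τ`) -/

section NegativeLine

/-- `J² = 1`. [cite: Jacobowitz1990, Ch. 2 §1 (p. 40)] -/
theorem J_mul_J : BallModel.J * BallModel.J = 1 := by
  rw [BallModel.J, Matrix.diagonal_mul_diagonal, ← Matrix.diagonal_one]
  congr 1
  funext i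
  fin_cases i <;> simp

/-- At the base point the reflection is `J` itself: `r_{(0,0,1)} = diag(1,1,-1)`. [cite: Deligne1979ShimuraVarieties, Prop. 2.3.10 (PDF p. 32)] -/
theorem reflJ_lift_x₀ : reflJ (BallModel.lift BallModel.x₀) = BallModel.J := by
  have hw : BallModel.lift BallModel.x₀ = ![0, 0, 1] := by
    funext k; fin_cases k <;> simp [BallModel.lift]
  have hq : formJ (BallModel.lift BallModel.x₀) = -1 := by
    rw [formJ_eq]
    have := BallModel.Q_lift BallModel.x₀
    simp [BallModel.Q, BallModel.lift]
  rw [reflJ, projJ, hq, hw]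
  ext a b
  fin_cases a <;> fin_cases b <;> norm_num [BallModel.J, Matrix.vecMul, dotProduct, Fin.sum_univ_three, Matrix.diagonal]

variable {g gi : Matrix (Fin 3) (Fin 3) ℂ}

/-- **`U(J)`-equivariance of the projection**: `P_{g w} = g·P_w·g⁻¹` for `gᴴ J g = J`. [cite: Deligne1979ShimuraVarieties, Prop. 2.3.10 (PDF p. 32)] -/
theorem projJ_mulVec_of_unitary (hg : gᴴ * BallModel.J * g = BallModel.J) (h1 : g * gi = 1) (w : Fin 3 → ℂ) :
    projJ (g *ᵥ w) = g * projJ w * gi := by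
  have hgJ : gᴴ * BallModel.J = BallModel.J * gi := by
    calc gᴴ * BallModel.J = gᴴ * BallModel.J * (g * gi) := by rw [h1, Matrix.mul_one]
      _ = BallModel.J * gi := by rw [← Matrix.mul_assoc, hg]
  rw [projJ, projJ, formJ, formJ, BallModel.form_invariant hg, Matrix.star_mulVec, Matrix.vecMul_vecMul, hgJ,
    ← Matrix.vecMul_vecMul, ← Matrix.vecMulVec_mul, ← Matrix.mul_vecMulVec, Matrix.mul_smul, Matrix.smul_mul]

/-- **`U(J)`-equivariance of the reflection**: `r_{g w} = g·r_w·g⁻¹` for `gᴴ J g = J`. [cite: Deligne1979ShimuraVarieties, Prop. 2.3.10 (PDF p. 32)] -/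
theorem reflJ_mulVec_of_unitary (hg : gᴴ * BallModel.J * g = BallModel.J) (h1 : g * gi = 1) (w : Fin 3 → ℂ) :
    reflJ (g *ᵥ w) = g * reflJ w * gi := by
  rw [reflJ, reflJ, projJ_mulVec_of_unitary hg h1, Matrix.mul_sub, Matrix.sub_mul, Matrix.mul_one, h1,
    Matrix.mul_smul, Matrix.smul_mul]

/-- `J·r_w = (g⁻¹)ᴴ·g⁻¹` for `w = c·g·(0,0,1)`, `g ∈ U(J)`: the hermitian form `J·r_w` is POSITIVE. [cite: Deligne1979ShimuraVarieties, Prop. 2.3.10 (PDF p. 32)] -/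
theorem J_mul_reflJ_eq (hg : gᴴ * BallModel.J * g = BallModel.J) (h1 : g * gi = 1) {c : ℂ} (hc : c ≠ 0) : BallModel.J * reflJ (c • (g *ᵥ BallModel.lift BallModel.x₀)) = giᴴ * gi := by
  have hgi : giᴴ * gᴴ = 1 := by rw [← Matrix.conjTranspose_mul, h1, Matrix.conjTranspose_one]
  have hJg : BallModel.J * g = giᴴ * BallModel.J := by
    calc BallModel.J * g = giᴴ * gᴴ * BallModel.J * g := by rw [hgi, Matrix.one_mul]
      _ = giᴴ * BallModel.J := by rw [Matrix.mul_assoc giᴴ, Matrix.mul_assoc giᴴ, hg]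
  rw [reflJ_smul hc, reflJ_mulVec_of_unitary hg h1, reflJ_lift_x₀, ← Matrix.mul_assoc, ← Matrix.mul_assoc, hJg,
    Matrix.mul_assoc giᴴ, J_mul_J, Matrix.mul_one]

/-- For a point `z` of the ball, `J·r_{lift z} = Nᴴ N` with `N ∈ GL₃(ℂ)` (transitivity ★ `exists_smul_x₀_eq` and
★ `lift_act`). [cite: Deligne1979ShimuraVarieties, Prop. 2.3.10 (PDF p. 32)] -/
theorem exists_J_mul_reflJ_lift_eq (z : BallModel.Ball) :
    ∃ N : GL (Fin 3) ℂ, BallModel.J * reflJ (BallModel.lift z) =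
      ((N : GL (Fin 3) ℂ) : Matrix (Fin 3) (Fin 3) ℂ)ᴴ * ((N : GL (Fin 3) ℂ) : Matrix (Fin 3) (Fin 3) ℂ) := by
  obtain ⟨g, hgz⟩ := BallModel.exists_smul_x₀_eq z
  refine ⟨(g : BallModel.GL3)⁻¹, ?_⟩
  have hlift : BallModel.lift z = (BallModel.W3 g BallModel.x₀ 2)⁻¹ • (BallModel.mat g *ᵥ BallModel.lift BallModel.x₀) := by
    rw [← hgz]; exact BallModel.lift_act g BallModel.x₀
  rw [hlift]
  exact J_mul_reflJ_eq (BallModel.mat_mem g) (by rw [BallModel.mat, ← Units.val_mul, mul_inv_cancel, Units.val_one])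
    (inv_ne_zero (BallModel.W3_2_ne_zero g _))

variable {L : Type} [Field L] (H : Matrix (Fin 3) (Fin 3) L) (τ : L →+* ℂ) (T : GL (Fin 3) ℂ)

/-- `(T r T⁻¹)ᴴ K = (N T⁻¹)ᴴ (N T⁻¹)` when `Tᴴ K T = J'` and `rᴴ J' = Nᴴ N`. [folklore] -/
private theorem conjTranspose_conj_mul_eq {Tm Ti r K J' Nm : Matrix (Fin 3) (Fin 3) ℂ} (h1 : Ti * Tm = 1)
    (h2 : Tm * Ti = 1) (hT : Tmᴴ * K * Tm = J') (hr : rᴴ * J' = Nmᴴ * Nm) :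
    (Tm * r * Ti)ᴴ * K = (Nm * Ti)ᴴ * (Nm * Ti) := by
  have hK : K = Tiᴴ * J' * Ti := by
    calc K = (Tm * Ti)ᴴ * K * (Tm * Ti) := by rw [h2, Matrix.conjTranspose_one, Matrix.one_mul, Matrix.mul_one]
      _ = Tiᴴ * (Tmᴴ * K * Tm) * Ti := by rw [Matrix.conjTranspose_mul]; simp only [Matrix.mul_assoc]
      _ = Tiᴴ * J' * Ti := by rw [hT]
  have h1' : Tmᴴ * Tiᴴ = 1 := by rw [← Matrix.conjTranspose_mul, h1, Matrix.conjTranspose_one]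
  rw [hK]
  simp only [Matrix.conjTranspose_mul, Matrix.mul_assoc]
  rw [← Matrix.mul_assoc Tmᴴ Tiᴴ, h1', Matrix.one_mul, ← Matrix.mul_assoc rᴴ J', hr]
  simp only [Matrix.mul_assoc]

/-- **`(s_z)ᴴ·H^τ = Nᴴ N` with `N` invertible** (so `(s_z v)ᴴ·H^τ·v = ‖Nv‖² > 0`): the hermitian form `H^τ·s_z` is
positive definite. [cite: Deligne1979ShimuraVarieties, Prop. 2.3.10 (PDF p. 32)] -/
theorem exists_conjTranspose_reflFrame_mul_eq
    (hT : (T : Matrix (Fin 3) (Fin 3) ℂ)ᴴ * H.map τ * (T : Matrix (Fin 3) (Fin 3) ℂ) = BallModel.J) (z : BallModel.Ball) :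
    ∃ N : GL (Fin 3) ℂ, (reflFrame T (BallModel.lift z))ᴴ * H.map τ =
      ((N : GL (Fin 3) ℂ) : Matrix (Fin 3) (Fin 3) ℂ)ᴴ * ((N : GL (Fin 3) ℂ) : Matrix (Fin 3) (Fin 3) ℂ) := by
  obtain ⟨N, hN⟩ := exists_J_mul_reflJ_lift_eq z
  refine ⟨N * T⁻¹, ?_⟩
  rw [Units.val_mul, reflFrame]
  rw [← conjTranspose_reflJ_mul_J] at hN
  exact conjTranspose_conj_mul_eq (by rw [← Units.val_mul, inv_mul_cancel, Units.val_one])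
    (by rw [← Units.val_mul, mul_inv_cancel, Units.val_one]) hT hN

/-- A `GL`-matrix has injective `mulVec`. [folklore] -/
private theorem mulVec_ne_zero_of_GL {n : Type} [Fintype n] [DecidableEq n] {R : Type} [CommRing R] (N : GL n R)
    {v : n → R} (hv : v ≠ 0) : ((N : GL n R) : Matrix n n R) *ᵥ v ≠ 0 := by
  intro h
  apply hv
  calc v = (((N⁻¹ : GL n R) : Matrix n n R) * ((N : GL n R) : Matrix n n R)) *ᵥ v := by
        rw [← Units.val_mul, inv_mul_cancel, Units.val_one, Matrix.one_mulVec]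
    _ = 0 := by rw [← Matrix.mulVec_mulVec, h, Matrix.mulVec_zero]

/-- **Positivity over `τ`**: `(s_z v)ᴴ·H^τ·v > 0` for `v ≠ 0`. [cite: Deligne1979ShimuraVarieties, Prop. 2.3.10 (PDF p. 32)]
[cite: Milne2005ShimuraVarieties, §8 p. 81] -/
theorem star_reflFrame_mulVec_dotProduct_pos
    (hT : (T : Matrix (Fin 3) (Fin 3) ℂ)ᴴ * H.map τ * (T : Matrix (Fin 3) (Fin 3) ℂ) = BallModel.J) (z : BallModel.Ball)
    {v : Fin 3 → ℂ} (hv : v ≠ 0) :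
    0 < star (reflFrame T (BallModel.lift z) *ᵥ v) ⬝ᵥ (H.map τ *ᵥ v) := by
  obtain ⟨N, hN⟩ := exists_conjTranspose_reflFrame_mul_eq H τ T hT z
  rw [Matrix.star_mulVec, Matrix.dotProduct_mulVec, Matrix.vecMul_vecMul, hN, ← Matrix.vecMul_vecMul,
    ← Matrix.dotProduct_mulVec, ← Matrix.star_mulVec]
  exact Matrix.dotProduct_star_self_pos_iff.2 (mulVec_ne_zero_of_GL N hv)

end NegativeLine

/-! #### The sign of `ψ_ℝ(Ax, x)` -/

section Definite

variable {L : Type} [Field L] (M : Type) [Field M] [NumberField M] [IsCMField M] (j : L →+* M)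
  (H : Matrix (Fin 3) (Fin 3) L) (ξ₀ ξ : M) (Φ : CMType M) (τ : L →+* ℂ) (T : GL (Fin 3) ℂ)

omit [NumberField M] [IsCMField M] in
/-- For `ρ ∈ Φ` not over `τ`, `ρ ∘ j` is not over the place of `τ` either (`ρ ∘ j = τ̄` would put `ρ̄` over `τ`, hence in `Φ`
by adaptedness — against the CM-type axiom). [cite: Deligne1979ShimuraVarieties, 2.3.9–2.3.10 (PDF p. 32)] -/
theorem mk_comp_ne_mk_of_isExtAdapted (hΦ : IsExtAdapted τ j Φ) (ρ : Φ.1) (h : ρ.1.comp j ≠ τ) :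
    InfinitePlace.mk (ρ.1.comp j) ≠ InfinitePlace.mk τ := by
  intro hmk
  rcases InfinitePlace.mk_eq_iff.1 hmk with h' | h'
  · exact h h'
  · have hc : (ComplexEmbedding.conjugate ρ.1).comp j = τ := by
      rw [← h']; rfl
    exact (Φ.2 ρ.1).1 ρ.2 (hΦ _ hc)

omit [NumberField M] [IsCMField M] in
/-- **`h_ρ(v) = (s_ρ v)ᴴ·H^{ρ∘j}·v > 0` for `v ≠ 0`** at every `ρ ∈ Φ`: over `τ` by ★ `star_reflFrame_mulVec_dotProduct_pos`,
elsewhere because `s_ρ = 1` and `H^{ρ∘j}` is positive definite. [cite: Deligne1979ShimuraVarieties, Prop. 2.3.10 (PDF p. 32)]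
[cite: Milne2005ShimuraVarieties, §8 p. 81] -/
theorem star_sComp_mulVec_dotProduct_pos
    (hT : (T : Matrix (Fin 3) (Fin 3) ℂ)ᴴ * H.map τ * (T : Matrix (Fin 3) (Fin 3) ℂ) = BallModel.J)
    (hpos : ∀ σ : L →+* ℂ, InfinitePlace.mk σ ≠ InfinitePlace.mk τ → (H.map σ).PosDef) (hΦ : IsExtAdapted τ j Φ)
    (z : BallModel.Ball) (ρ : Φ.1) {v : Fin 3 → ℂ} (hv : v ≠ 0) :
    0 < star (sComp M j Φ τ T (BallModel.lift z) ρ *ᵥ v) ⬝ᵥ (H.map (ρ.1.comp j) *ᵥ v) := by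
  by_cases h : ρ.1.comp j = τ
  · rw [sComp_of_eq _ h, h]
    exact star_reflFrame_mulVec_dotProduct_pos H τ T hT z hv
  · rw [sComp_of_ne _ h, Matrix.one_mulVec]
    exact (hpos _ (mk_comp_ne_mk_of_isExtAdapted M j Φ τ hΦ ρ h)).dotProduct_mulVec_pos hv

omit [NumberField M] [IsCMField M] in
/-- `h_ρ(v) ≥ 0`. [cite: Deligne1979ShimuraVarieties, Prop. 2.3.10 (PDF p. 32)] -/
theorem star_sComp_mulVec_dotProduct_nonneg
    (hT : (T : Matrix (Fin 3) (Fin 3) ℂ)ᴴ * H.map τ * (T : Matrix (Fin 3) (Fin 3) ℂ) = BallModel.J)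
    (hpos : ∀ σ : L →+* ℂ, InfinitePlace.mk σ ≠ InfinitePlace.mk τ → (H.map σ).PosDef) (hΦ : IsExtAdapted τ j Φ)
    (z : BallModel.Ball) (ρ : Φ.1) (v : Fin 3 → ℂ) :
    0 ≤ star (sComp M j Φ τ T (BallModel.lift z) ρ *ᵥ v) ⬝ᵥ (H.map (ρ.1.comp j) *ᵥ v) := by
  by_cases hv : v = 0
  · rw [hv, Matrix.mulVec_zero, Matrix.mulVec_zero, dotProduct_zero]
  · exact (star_sComp_mulVec_dotProduct_pos M j H Φ τ T hT hpos hΦ z ρ hv).le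

omit [IsCMField M] in
/-- `(A x)_ρ = A_ρ x_ρ`. [cite: Shimura1998, §6.2 Thm. 4, p. 44] -/
theorem realEmb_comp_mulVec {m n : Type} [Fintype n] (ρ : Φ.1) (A : Matrix m n (ℝ ⊗[ℚ] M)) (x : n → ℝ ⊗[ℚ] M) :
    ⇑(realEmb M Φ ρ) ∘ (A *ᵥ x) = A.map (realEmb M Φ ρ) *ᵥ (⇑(realEmb M Φ ρ) ∘ x) := by
  funext i
  rw [Function.comp_apply, ← RingHom.coe_coe, RingHom.map_mulVec]

omit [IsCMField M] in
/-- A non-zero vector over `ℝ ⊗_ℚ M` has a non-zero `Φ`-component. [cite: Shimura1998, §6.2, proof of Thm. 3, p. 42] -/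
theorem exists_realEmb_comp_ne_zero {n : Type} {x : n → ℝ ⊗[ℚ] M} (hx : x ≠ 0) :
    ∃ ρ : Φ.1, ⇑(realEmb M Φ ρ) ∘ x ≠ 0 := by
  obtain ⟨i, hi⟩ := Function.ne_iff.1 hx
  by_contra hall
  push Not at hall
  apply hi
  exact eq_of_realEmb_eq M Φ fun ρ => by
    have := congr_fun (hall ρ) i
    rw [Function.comp_apply, Pi.zero_apply] at this
    rw [this, Pi.zero_apply, map_zero]

/-- **`ψ_ℝ(Ax, x) < 0` for `x ≠ 0`**, `A = diag(iPhi, iPhi·s_z)`, `ψ_ℝ` the trace form of `diag(ξ₀, ξ·H^j)` over `ℝ ⊗_ℚ M`: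
the Riemann form `ψ(u, h(i)u)` is (negative) DEFINITE under the sign conventions `Im ρ(ξ₀) < 0`, `Im ρ(ξ) < 0` (`ρ ∈ Φ`).
[cite: Deligne1979ShimuraVarieties, Prop. 2.3.10 (PDF p. 32)] [cite: Milne2005ShimuraVarieties, §6 p. 67 («ψ(u, h(i)u) definite»), §8 p. 81] -/
theorem traceForm_blockGL_mulVec_self_neg
    (hT : (T : Matrix (Fin 3) (Fin 3) ℂ)ᴴ * H.map τ * (T : Matrix (Fin 3) (Fin 3) ℂ) = BallModel.J)
    (hξ₀ : ∀ ρ : Φ.1, (ρ.1 ξ₀).im < 0) (hξ : ∀ ρ : Φ.1, (ρ.1 ξ).im < 0)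
    (hpos : ∀ σ : L →+* ℂ, InfinitePlace.mk σ ≠ InfinitePlace.mk τ → (H.map σ).PosDef) (hΦ : IsExtAdapted τ j Φ)
    (z : BallModel.Ball) {x : Fin 1 ⊕ Fin 3 → ℝ ⊗[ℚ] M} (hx : x ≠ 0) :
    traceForm (conjR M ℝ) (auxGramR M j H ξ₀ ξ ℝ)
        (((blockGL (ℝ ⊗[ℚ] M) (iPhi M Φ, sPhi M j Φ τ T z) : GL (Fin 1 ⊕ Fin 3) (ℝ ⊗[ℚ] M)) :
          Matrix (Fin 1 ⊕ Fin 3) (Fin 1 ⊕ Fin 3) (ℝ ⊗[ℚ] M)) *ᵥ x) x < 0 := by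
  rw [traceForm_conjR_eq_sum]
  -- the `ρ`-summand in closed form
  have hval : ∀ ρ : Φ.1,
      star (⇑(realEmb M Φ ρ) ∘ (((blockGL (ℝ ⊗[ℚ] M) (iPhi M Φ, sPhi M j Φ τ T z) : GL (Fin 1 ⊕ Fin 3) (ℝ ⊗[ℚ] M)) :
          Matrix (Fin 1 ⊕ Fin 3) (Fin 1 ⊕ Fin 3) (ℝ ⊗[ℚ] M)) *ᵥ x)) ⬝ᵥ
        ((auxGramR M j H ξ₀ ξ ℝ).map (realEmb M Φ ρ) *ᵥ (⇑(realEmb M Φ ρ) ∘ x)) =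
      -Complex.I * (ρ.1 ξ₀ * (star ((⇑(realEmb M Φ ρ) ∘ x) ∘ Sum.inl) ⬝ᵥ ((⇑(realEmb M Φ ρ) ∘ x) ∘ Sum.inl)) +
        ρ.1 ξ * (star (sComp M j Φ τ T (BallModel.lift z) ρ *ᵥ ((⇑(realEmb M Φ ρ) ∘ x) ∘ Sum.inr)) ⬝ᵥ
          (H.map (ρ.1.comp j) *ᵥ ((⇑(realEmb M Φ ρ) ∘ x) ∘ Sum.inr)))) := by
    intro ρ
    rw [realEmb_comp_mulVec, coe_blockGL_iPhi_sPhi_map_realEmb, auxGramR_map_realEmb, star_block_mulVec_dotProduct]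
  have hle : ∀ ρ ∈ (Finset.univ : Finset Φ.1),
      (star (⇑(realEmb M Φ ρ) ∘ (((blockGL (ℝ ⊗[ℚ] M) (iPhi M Φ, sPhi M j Φ τ T z) : GL (Fin 1 ⊕ Fin 3) (ℝ ⊗[ℚ] M)) :
          Matrix (Fin 1 ⊕ Fin 3) (Fin 1 ⊕ Fin 3) (ℝ ⊗[ℚ] M)) *ᵥ x)) ⬝ᵥ
        ((auxGramR M j H ξ₀ ξ ℝ).map (realEmb M Φ ρ) *ᵥ (⇑(realEmb M Φ ρ) ∘ x))).re ≤ 0 := by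
    intro ρ _
    rw [hval ρ]
    exact (re_neg_I_mul_nonpos (hξ₀ ρ) (hξ ρ) (dotProduct_star_self_nonneg _)
      (star_sComp_mulVec_dotProduct_nonneg M j H Φ τ T hT hpos hΦ z ρ _)).1
  obtain ⟨ρ₀, hρ₀⟩ := exists_realEmb_comp_ne_zero M Φ hx
  have hlt : (star (⇑(realEmb M Φ ρ₀) ∘ (((blockGL (ℝ ⊗[ℚ] M) (iPhi M Φ, sPhi M j Φ τ T z) : GL (Fin 1 ⊕ Fin 3) (ℝ ⊗[ℚ] M)) :
          Matrix (Fin 1 ⊕ Fin 3) (Fin 1 ⊕ Fin 3) (ℝ ⊗[ℚ] M)) *ᵥ x)) ⬝ᵥ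
        ((auxGramR M j H ξ₀ ξ ℝ).map (realEmb M Φ ρ₀) *ᵥ (⇑(realEmb M Φ ρ₀) ∘ x))).re < 0 := by
    refine lt_of_le_of_ne (hle ρ₀ (Finset.mem_univ _)) fun h0 => hρ₀ ?_
    rw [hval ρ₀] at h0
    obtain ⟨hn, hh⟩ := (re_neg_I_mul_nonpos (hξ₀ ρ₀) (hξ ρ₀) (dotProduct_star_self_nonneg _)
      (star_sComp_mulVec_dotProduct_nonneg M j H Φ τ T hT hpos hΦ z ρ₀ _)).2 h0
    have h₁ : (⇑(realEmb M Φ ρ₀) ∘ x) ∘ Sum.inl = 0 := dotProduct_star_self_eq_zero.1 hn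
    have h₂ : (⇑(realEmb M Φ ρ₀) ∘ x) ∘ Sum.inr = 0 := by
      by_contra hne
      exact (star_sComp_mulVec_dotProduct_pos M j H Φ τ T hT hpos hΦ z ρ₀ hne).ne' hh
    funext i
    rcases i with a | b
    · exact congr_fun h₁ a
    · exact congr_fun h₂ b
  have hsum := Finset.sum_lt_sum hle ⟨ρ₀, Finset.mem_univ _, hlt⟩
  rw [Finset.sum_const_zero] at hsum
  linarith

end Definite

/-! #### Assembly: `-J ∈ C0 δ`, `J ∈ C0pm δ` -/

section Positivity

variable {L : Type} [Field L] {M : Type} [Field M] [NumberField M] [IsCMField M] {j : L →+* M}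
  {H : Matrix (Fin 3) (Fin 3) L} {ξ₀ ξ : M} {g : ℕ} {δ : Fin g → ℕ}
  (F : SymplecticFrame M j H ξ₀ ξ g δ) (τ : L →+* ℂ) (Φ : CMType M) (T : GL (Fin 3) ℂ) (z : BallModel.Ball)

/-- **`E_δ(Jv, v) = ψ_ℝ(Ax, x)`**: the value of the symplectic form on `(Jv, v)` is the trace form on the coordinates
`x ∈ (ℝ ⊗ M)^{1⊕3}` of `v` in the frame (`v = P_ℝ u`, `u = Q_ℝ v` the coordinates in the basis `eᵢ ⊗ (1 ⊗ b_k)`).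
[cite: Deligne1979ShimuraVarieties, Prop. 2.3.10 (PDF p. 32)] [cite: Milne2005ShimuraVarieties, §8 p. 81] -/
theorem auxComplexStructure_mulVec_dotProduct (v : Fin g ⊕ Fin g → ℝ) :
    (auxComplexStructure F τ Φ T z *ᵥ v) ⬝ᵥ (typeFormOver δ ℝ *ᵥ v) =
      traceForm (conjR M ℝ) (auxGramR M j H ξ₀ ξ ℝ)
        (((blockGL (ℝ ⊗[ℚ] M) (iPhi M Φ, sPhi M j Φ τ T z) : GL (Fin 1 ⊕ Fin 3) (ℝ ⊗[ℚ] M)) :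
            Matrix (Fin 1 ⊕ Fin 3) (Fin 1 ⊕ Fin 3) (ℝ ⊗[ℚ] M)) *ᵥ
          (resBasis (m := Fin 1 ⊕ Fin 3) (Algebra.TensorProduct.basis ℝ (ratBasis M))).equivFun.symm (frameQR ℝ F *ᵥ v))
        ((resBasis (m := Fin 1 ⊕ Fin 3) (Algebra.TensorProduct.basis ℝ (ratBasis M))).equivFun.symm (frameQR ℝ F *ᵥ v)) := by
  set rb := resBasis (m := Fin 1 ⊕ Fin 3) (Algebra.TensorProduct.basis ℝ (ratBasis M)) with hrb
  set u := frameQR ℝ F *ᵥ v with hu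
  have hv : v = framePR ℝ F *ᵥ u := by
    rw [hu, Matrix.mulVec_mulVec, framePR_mul_frameQR, Matrix.one_mulVec]
  -- `J v = P (A_r u)`
  have hJ : auxComplexStructure F τ Φ T z *ᵥ v =
      framePR ℝ F *ᵥ (resMatrix (Algebra.TensorProduct.basis ℝ (ratBasis M))
        (((blockGL (ℝ ⊗[ℚ] M) (iPhi M Φ, sPhi M j Φ τ T z) : GL (Fin 1 ⊕ Fin 3) (ℝ ⊗[ℚ] M)) :
          Matrix (Fin 1 ⊕ Fin 3) (Fin 1 ⊕ Fin 3) (ℝ ⊗[ℚ] M))) *ᵥ u) := by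
    rw [auxComplexStructure_def, auxRep, MonoidHom.comp_apply, MonoidHom.comp_apply, coe_conjRect, coe_resGL, hu,
      Matrix.mulVec_mulVec, Matrix.mulVec_mulVec]
  -- `(P w) ⬝ (E (P u)) = w ⬝ (ᵗP E P u) = w ⬝ (G u)`
  have hPEP : ∀ w : (Fin 1 ⊕ Fin 3) × Fin (Module.finrank ℚ M) → ℝ,
      (framePR ℝ F *ᵥ w) ⬝ᵥ (typeFormOver δ ℝ *ᵥ (framePR ℝ F *ᵥ u)) =
        w ⬝ᵥ (traceGram (m := Fin 1 ⊕ Fin 3) (conjR M ℝ) (auxGramR M j H ξ₀ ξ ℝ)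
          (Algebra.TensorProduct.basis ℝ (ratBasis M)) *ᵥ u) := by
    intro w
    rw [traceGram_baseChange_eq_frame ℝ F, ← Matrix.mulVec_mulVec, ← Matrix.mulVec_mulVec, Matrix.dotProduct_mulVec w,
      Matrix.vecMul_transpose]
  rw [hJ, hv, hPEP, traceGram, LinearMap.BilinForm.dotProduct_toMatrix_mulVec, ← toMatrix_resBasis_mulVecLin, ← hrb]
  -- `rb.equivFun.symm (A_r u) = A (rb.equivFun.symm u)`
  have hsymm : ∀ y : Fin 1 ⊕ Fin 3 → ℝ ⊗[ℚ] M, rb.equivFun.symm ⇑(rb.repr y) = y := fun y =>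
    rb.equivFun.symm_apply_apply y
  have hx : u = ⇑(rb.repr (rb.equivFun.symm u)) := by
    funext p
    rw [← Module.Basis.equivFun_apply, LinearEquiv.apply_symm_apply]
  conv_lhs => rw [hx, LinearMap.toMatrix_mulVec_repr, hsymm, hsymm]
  rfl

/-- **`E_δ(Jv, v) < 0` for `v ≠ 0`** under the sign conventions. [cite: Deligne1979ShimuraVarieties, Prop. 2.3.10 (PDF p. 32)]
[cite: Milne2005ShimuraVarieties, §6 p. 68, §8 p. 81] -/
theorem auxComplexStructure_mulVec_dotProduct_neg (hT : formCongr (starRingEnd ℂ) T (H.map τ) = BallModel.J)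
    (hξ₀ : ∀ ρ : Φ.1, (ρ.1 ξ₀).im < 0) (hξ : ∀ ρ : Φ.1, (ρ.1 ξ).im < 0)
    (hpos : ∀ σ : L →+* ℂ, InfinitePlace.mk σ ≠ InfinitePlace.mk τ → (H.map σ).PosDef) (hΦ : IsExtAdapted τ j Φ)
    {v : Fin g ⊕ Fin g → ℝ} (hv : v ≠ 0) :
    (auxComplexStructure F τ Φ T z *ᵥ v) ⬝ᵥ (typeFormOver δ ℝ *ᵥ v) < 0 := by
  rw [formCongr_star] at hT
  rw [auxComplexStructure_mulVec_dotProduct]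
  refine traceForm_blockGL_mulVec_self_neg M j H ξ₀ ξ Φ τ T hT hξ₀ hξ hpos hΦ z fun hx => hv ?_
  have hu : frameQR ℝ F *ᵥ v = 0 := by
    have := congrArg (resBasis (m := Fin 1 ⊕ Fin 3) (Algebra.TensorProduct.basis ℝ (ratBasis M))).equivFun hx
    rwa [LinearEquiv.apply_symm_apply, map_zero] at this
  calc v = framePR ℝ F *ᵥ (frameQR ℝ F *ᵥ v) := by rw [Matrix.mulVec_mulVec, framePR_mul_frameQR, Matrix.one_mulVec]
    _ = 0 := by rw [hu, Matrix.mulVec_zero]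

/-- **`-J_{β,Φ}(z) ∈ C0 δ`**: `-J` is a symplectic complex structure with `ᵗ(-J)·E_δ` positive definite (Lange's `X⁺` half),
i.e. `E_δ(Jv, v) < 0` — the sign the tree's conventions `Im ρ(ξ) < 0`, `Im ρ(ξ₀) < 0` produce.
[cite: Deligne1979ShimuraVarieties, Prop. 2.3.10 (PDF p. 32)] [cite: Milne2005ShimuraVarieties, §6 p. 68, §8 p. 81]
[cite: Lange2023AbelianVarietiesComplex, §7.1.2 (7.1) (p0326–p0327)] -/
theorem neg_auxComplexStructure_mem_C0 (hT : formCongr (starRingEnd ℂ) T (H.map τ) = BallModel.J)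
    (hξ₀ : ∀ ρ : Φ.1, (ρ.1 ξ₀).im < 0) (hξ : ∀ ρ : Φ.1, (ρ.1 ξ).im < 0)
    (hpos : ∀ σ : L →+* ℂ, InfinitePlace.mk σ ≠ InfinitePlace.mk τ → (H.map σ).PosDef) (hΦ : IsExtAdapted τ j Φ) :
    -auxComplexStructure F τ Φ T z ∈ SiegelModuli.C0 δ := by
  have hS := isSymplecticComplexStructure_auxComplexStructure F τ Φ T z hT
  set J := auxComplexStructure F τ Φ T z with hJdef
  have hEJ : SiegelModuli.realTypeForm δ * J = -(Jᵀ * SiegelModuli.realTypeForm δ) := by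
    calc SiegelModuli.realTypeForm δ * J = Jᵀ * SiegelModuli.realTypeForm δ * J * J := by rw [hS.transpose_mul_mul]
      _ = Jᵀ * SiegelModuli.realTypeForm δ * (J * J) := by simp only [Matrix.mul_assoc]
      _ = -(Jᵀ * SiegelModuli.realTypeForm δ) := by rw [hS.mul_self, Matrix.mul_neg, Matrix.mul_one]
  refine ⟨⟨by rw [neg_mul_neg, hS.mul_self], by rw [Matrix.transpose_neg, Matrix.neg_mul, neg_mul_neg, hS.transpose_mul_mul]⟩,
    Matrix.PosDef.of_dotProduct_mulVec_pos ?_ fun v hv => ?_⟩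
  · -- symmetry of `ᵗ(-J) E`
    rw [Matrix.IsHermitian, Matrix.conjTranspose_eq_transpose_of_trivial, Matrix.transpose_mul, Matrix.transpose_transpose,
      SiegelModuli.transpose_realTypeForm, neg_mul_neg, hEJ, Matrix.transpose_neg, Matrix.neg_mul]
  · rw [star_trivial, Matrix.transpose_neg, Matrix.neg_mul, Matrix.neg_mulVec, dotProduct_neg, ← Matrix.mulVec_mulVec,
      Matrix.dotProduct_mulVec, Matrix.vecMul_transpose, ← typeFormOver_real_eq_realTypeForm]
    exact neg_pos.2 (auxComplexStructure_mulVec_dotProduct_neg F τ Φ T z hT hξ₀ hξ hpos hΦ hv)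

/-- **`J_{β,Φ}(z) ∈ C0pm δ = X`**: the complex structure of [Deligne1979ShimuraVarieties] 2.3.10 is a point of the
`GSp_δ(ℝ)`-conjugacy class `X = X⁺ ⊔ X⁻` of ★ `SiegelShimuraSet` (in the `X⁻` half for the tree's sign conventions).
Hypotheses: the frame `Tᴴ H^τ T = diag(1,1,-1)`, the signs `Im ρ(ξ₀) < 0`, `Im ρ(ξ) < 0` (`ρ ∈ Φ`), definiteness of `H` at
the places of `L` other than that of `τ`, and adaptedness `IsExtAdapted τ j Φ`.
[cite: Deligne1979ShimuraVarieties, Prop. 2.3.10 (PDF p. 32)] [cite: Milne2005ShimuraVarieties, §6 pp. 68–70, §8 p. 81] -/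
theorem auxComplexStructure_mem_C0pm (hT : formCongr (starRingEnd ℂ) T (H.map τ) = BallModel.J)
    (hξ₀ : ∀ ρ : Φ.1, (ρ.1 ξ₀).im < 0) (hξ : ∀ ρ : Φ.1, (ρ.1 ξ).im < 0)
    (hpos : ∀ σ : L →+* ℂ, InfinitePlace.mk σ ≠ InfinitePlace.mk τ → (H.map σ).PosDef) (hΦ : IsExtAdapted τ j Φ) :
    auxComplexStructure F τ Φ T z ∈ C0pm δ :=
  Or.inr (neg_auxComplexStructure_mem_C0 F τ Φ T z hT hξ₀ hξ hpos hΦ)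

/-- **The point `J_{β,Φ}(z) ∈ X = C0pm δ`** packaged as an element of the `C0pm δ` subtype (the first coordinate of the
intended map to ★ `SiegelShimuraSet δ K`). [cite: Deligne1979ShimuraVarieties, Prop. 2.3.10 (PDF p. 32)] [cite: Milne2005ShimuraVarieties, §6 p. 68] -/
def auxPoint (hT : formCongr (starRingEnd ℂ) T (H.map τ) = BallModel.J)
    (hξ₀ : ∀ ρ : Φ.1, (ρ.1 ξ₀).im < 0) (hξ : ∀ ρ : Φ.1, (ρ.1 ξ).im < 0)
    (hpos : ∀ σ : L →+* ℂ, InfinitePlace.mk σ ≠ InfinitePlace.mk τ → (H.map σ).PosDef) (hΦ : IsExtAdapted τ j Φ) :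
    C0pm δ :=
  ⟨auxComplexStructure F τ Φ T z, auxComplexStructure_mem_C0pm F τ Φ T z hT hξ₀ hξ hpos hΦ⟩

/-- Underlying matrix of `auxPoint`. [cite: Deligne1979ShimuraVarieties, Prop. 2.3.10 (PDF p. 32)] -/
@[simp] theorem coe_auxPoint (hT : formCongr (starRingEnd ℂ) T (H.map τ) = BallModel.J)
    (hξ₀ : ∀ ρ : Φ.1, (ρ.1 ξ₀).im < 0) (hξ : ∀ ρ : Φ.1, (ρ.1 ξ).im < 0)
    (hpos : ∀ σ : L →+* ℂ, InfinitePlace.mk σ ≠ InfinitePlace.mk τ → (H.map σ).PosDef) (hΦ : IsExtAdapted τ j Φ) :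
    ((auxPoint F τ Φ T z hT hξ₀ hξ hpos hΦ : C0pm δ) : Matrix (Fin g ⊕ Fin g) (Fin g ⊕ Fin g) ℝ) =
      auxComplexStructure F τ Φ T z :=
  rfl

end Positivity

/-! ### §7. The `σ`-evaluations `ℝ ⊗_ℚ M → ℂ` for ALL complex embeddings `σ` (complexification bookkeeping)

`(ℝ ⊗_ℚ M) ⊗_ℝ ℂ ≅ ℂ^{Hom(M,ℂ)}`: besides the `Φ`-components `realEmb ρ` (`ρ ∈ Φ`) one needs, for the eigen-decomposition
of `J_{β,Φ}` over `ℂ`, the conjugate components `σ ∉ Φ`; `embOf σ` is the `σ`-evaluation for every `σ`, and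
`embOf σ̄ = conj ∘ embOf σ`. [cite: Shimura1998, §6.2 Thm. 4, p. 44] [cite: Deligne1979ShimuraVarieties, Prop. 2.3.10 (PDF p. 32)] -/

section AllEmbeddings

variable (M : Type) [Field M] [NumberField M]

/-- **The `σ`-evaluation `ℝ ⊗_ℚ M →ₐ[ℝ] ℂ`, `r ⊗ x ↦ r·σ(x)`, for ANY complex embedding `σ`** (for `σ ∈ Φ` it is
★ `realEmb`, `realEmb_eq_embOf`). [cite: Shimura1998, §6.2 Thm. 4, p. 44] -/
def embOf (σ : M →+* ℂ) : ℝ ⊗[ℚ] M →ₐ[ℝ] ℂ :=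
  Algebra.TensorProduct.lift (Algebra.ofId ℝ ℂ) σ.toRatAlgHom (fun _ _ => Commute.all _ _)

/-- `embOf σ (r ⊗ x) = r·σ(x)`. [cite: Shimura1998, §6.2 Thm. 4, p. 44] -/
@[simp] theorem embOf_tmul (σ : M →+* ℂ) (r : ℝ) (x : M) : embOf M σ (r ⊗ₜ x) = (r : ℂ) * σ x := by
  rw [embOf, Algebra.TensorProduct.lift_tmul, Algebra.ofId_apply, Complex.coe_algebraMap, RingHom.toRatAlgHom_apply]

/-- For `ρ ∈ Φ`, `realEmb ρ = embOf ρ` (pointwise). [cite: Shimura1998, §6.2 Thm. 4, p. 44] -/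
theorem realEmb_apply_eq_embOf (Φ : CMType M) (ρ : Φ.1) (x : ℝ ⊗[ℚ] M) : realEmb M Φ ρ x = embOf M ρ.1 x := by
  induction x using TensorProduct.induction_on with
  | zero => simp
  | tmul r m => rw [realEmb_tmul, embOf_tmul]
  | add x y hx hy => rw [map_add, map_add, hx, hy]

/-- For `ρ ∈ Φ`, `realEmb ρ = embOf ρ`. [cite: Shimura1998, §6.2 Thm. 4, p. 44] -/
theorem realEmb_eq_embOf (Φ : CMType M) (ρ : Φ.1) : realEmb M Φ ρ = embOf M ρ.1 :=
  AlgHom.ext (realEmb_apply_eq_embOf M Φ ρ)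

/-- **`embOf σ̄ = conj ∘ embOf σ`**: the conjugate embedding's evaluation is the conjugate of the evaluation.
[cite: Shimura1998, §6.2, proof of Thm. 3, p. 42] -/
theorem embOf_conjugate (σ : M →+* ℂ) (x : ℝ ⊗[ℚ] M) :
    embOf M (ComplexEmbedding.conjugate σ) x = conj (embOf M σ x) := by
  induction x using TensorProduct.induction_on with
  | zero => simp
  | tmul r m => rw [embOf_tmul, embOf_tmul, ComplexEmbedding.conjugate_coe_eq, map_mul, Complex.conj_ofReal]
  | add x y hx hy => rw [map_add, map_add, map_add, hx, hy]

omit [NumberField M] in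
/-- For `σ ∉ Φ` the conjugate `σ̄` lies in `Φ` (the CM-type axiom, ★ `CMTypeOps.conjugate_mem_iff_notMem`).
[cite: Shimura1998, §5.2 Thm. 1 (CM1)–(CM2), p. 40] -/
theorem conjugate_mem_of_not_mem (Φ : CMType M) {σ : M →+* ℂ} (hσ : σ ∉ Φ.1) : ComplexEmbedding.conjugate σ ∈ Φ.1 :=
  (Literature.NumberTheory.ComplexMultiplication.CMTypeOps.conjugate_mem_iff_notMem Φ σ).2 hσ

/-- **`embOf σ = conj ∘ realEmb σ̄`** whenever `σ̄ ∈ Φ` (in particular for every `σ ∉ Φ`, `conjugate_mem_of_not_mem`).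
[cite: Shimura1998, §6.2, proof of Thm. 3, p. 42] -/
theorem embOf_eq_conj_realEmb (Φ : CMType M) (σ : M →+* ℂ) (h : ComplexEmbedding.conjugate σ ∈ Φ.1) (x : ℝ ⊗[ℚ] M) :
    embOf M σ x = conj (realEmb M Φ ⟨ComplexEmbedding.conjugate σ, h⟩ x) := by
  rw [realEmb_apply_eq_embOf, ← embOf_conjugate, ComplexEmbedding.involutive_conjugate]

/-- Joint injectivity over ALL `σ` (a fortiori from ★ `eq_of_realEmb_eq`). [cite: Shimura1998, §6.2, proof of Thm. 3, p. 42] -/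
theorem eq_of_embOf_eq (Φ : CMType M) {x y : ℝ ⊗[ℚ] M} (h : ∀ σ : M →+* ℂ, embOf M σ x = embOf M σ y) : x = y :=
  eq_of_realEmb_eq M Φ fun ρ => by rw [realEmb_apply_eq_embOf, realEmb_apply_eq_embOf, h]

variable (Φ : CMType M)

/-- `embOf σ iPhi = i` for `σ ∈ Φ`. [cite: Deligne1979ShimuraVarieties, Prop. 2.3.10 (PDF p. 32)] -/
theorem embOf_iPhiVal_of_mem {σ : M →+* ℂ} (hσ : σ ∈ Φ.1) : embOf M σ (iPhiVal M Φ) = Complex.I := by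
  rw [← realEmb_apply_eq_embOf M Φ ⟨σ, hσ⟩, realEmb_iPhiVal]

/-- `embOf σ iPhi = -i` for `σ ∉ Φ` (the conjugate places). [cite: Deligne1979ShimuraVarieties, Prop. 2.3.10 (PDF p. 32)] -/
theorem embOf_iPhiVal_of_not_mem {σ : M →+* ℂ} (hσ : σ ∉ Φ.1) : embOf M σ (iPhiVal M Φ) = -Complex.I := by
  rw [embOf_eq_conj_realEmb M Φ σ (conjugate_mem_of_not_mem M Φ hσ), realEmb_iPhiVal, Complex.conj_I]

variable [IsCMField M]

/-- `embOf σ ∘ (1 ⊗ c) = conj ∘ embOf σ` for every `σ`. [cite: Deligne1979ShimuraVarieties, 2.3.9 (PDF p. 32)] -/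
theorem embOf_conjR (σ : M →+* ℂ) (x : ℝ ⊗[ℚ] M) : embOf M σ (conjR M ℝ x) = conj (embOf M σ x) := by
  induction x using TensorProduct.induction_on with
  | zero => simp
  | tmul r m => rw [conjR_tmul, embOf_tmul, embOf_tmul, map_mul, Complex.conj_ofReal, IsCMField.complexEmbedding_complexConj M]
  | add x y hx hy => simp only [map_add, hx, hy]

variable {L : Type} [Field L] (j : L →+* M) (τ : L →+* ℂ) (T : GL (Fin 3) ℂ)

omit [IsCMField M] in
/-- The `σ`-image of `s_w` for `σ ∈ Φ`: `sComp w σ`. [cite: Deligne1979ShimuraVarieties, Prop. 2.3.10 (PDF p. 32)] -/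
theorem sMat_map_embOf_of_mem (w : Fin 3 → ℂ) {σ : M →+* ℂ} (hσ : σ ∈ Φ.1) :
    (sMat M j Φ τ T w).map (embOf M σ) = sComp M j Φ τ T w ⟨σ, hσ⟩ := by
  rw [← realEmb_eq_embOf M Φ ⟨σ, hσ⟩, sMat_map_realEmb]

omit [IsCMField M] in
/-- The `σ`-image of `s_w` when `σ̄ ∈ Φ` (every `σ ∉ Φ`): the CONJUGATE of `sComp w σ̄`. [cite: Deligne1979ShimuraVarieties, Prop. 2.3.10 (PDF p. 32)] -/
theorem sMat_map_embOf_of_conjugate_mem (w : Fin 3 → ℂ) (σ : M →+* ℂ) (h : ComplexEmbedding.conjugate σ ∈ Φ.1) :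
    (sMat M j Φ τ T w).map (embOf M σ) = (sComp M j Φ τ T w ⟨ComplexEmbedding.conjugate σ, h⟩).map (starRingEnd ℂ) := by
  rw [← sMat_map_realEmb, Matrix.map_map]
  ext a b
  simp only [Matrix.map_apply, Function.comp_apply, embOf_eq_conj_realEmb M Φ σ h]

omit [IsCMField M] in
/-- The `σ`-image of the block matrix `diag(iPhi, iPhi·s_z)`: `diag(±i, ±i·σ̃(s_z))`. [cite: Deligne1979ShimuraVarieties, Prop. 2.3.10 (PDF p. 32)] -/
theorem coe_blockGL_iPhi_sPhi_map_embOf (σ : M →+* ℂ) (z : BallModel.Ball) :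
    (((blockGL (ℝ ⊗[ℚ] M) (iPhi M Φ, sPhi M j Φ τ T z) : GL (Fin 1 ⊕ Fin 3) (ℝ ⊗[ℚ] M)) :
        Matrix (Fin 1 ⊕ Fin 3) (Fin 1 ⊕ Fin 3) (ℝ ⊗[ℚ] M)).map (embOf M σ)) =
      Matrix.fromBlocks (embOf M σ (iPhiVal M Φ) • (1 : Matrix (Fin 1) (Fin 1) ℂ)) 0 0
        (embOf M σ (iPhiVal M Φ) • (sMat M j Φ τ T (BallModel.lift z)).map (embOf M σ)) := by
  rw [coe_blockGL, Matrix.fromBlocks_map, smul_map, smul_map, Matrix.map_one _ (map_zero _) (map_one _),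
    Matrix.map_zero _ (map_zero _), Matrix.map_zero _ (map_zero _), coe_iPhi, coe_sPhi]

omit [IsCMField M] in
/-- **(E1)** the `σ`-image of `diag(iPhi, iPhi·s_z)` for `σ ∈ Φ`: `diag(i, i·sComp σ)`. [cite: Deligne1979ShimuraVarieties, Prop. 2.3.10 (PDF p. 32)] -/
theorem coe_blockGL_iPhi_sPhi_map_embOf_of_mem {σ : M →+* ℂ} (hσ : σ ∈ Φ.1) (z : BallModel.Ball) :
    (((blockGL (ℝ ⊗[ℚ] M) (iPhi M Φ, sPhi M j Φ τ T z) : GL (Fin 1 ⊕ Fin 3) (ℝ ⊗[ℚ] M)) :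
        Matrix (Fin 1 ⊕ Fin 3) (Fin 1 ⊕ Fin 3) (ℝ ⊗[ℚ] M)).map (embOf M σ)) =
      Matrix.fromBlocks (Complex.I • (1 : Matrix (Fin 1) (Fin 1) ℂ)) 0 0
        (Complex.I • sComp M j Φ τ T (BallModel.lift z) ⟨σ, hσ⟩) := by
  rw [coe_blockGL_iPhi_sPhi_map_embOf, embOf_iPhiVal_of_mem M Φ hσ, sMat_map_embOf_of_mem M Φ j τ T _ hσ]

omit [IsCMField M] in
/-- **(E2)** the `σ`-image of `diag(iPhi, iPhi·s_z)` for `σ ∉ Φ` (`σ̄ ∈ Φ`): `diag(-i, -i·conj(sComp σ̄))`.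
[cite: Deligne1979ShimuraVarieties, Prop. 2.3.10 (PDF p. 32)] -/
theorem coe_blockGL_iPhi_sPhi_map_embOf_of_not_mem {σ : M →+* ℂ} (hσ : σ ∉ Φ.1)
    (h : ComplexEmbedding.conjugate σ ∈ Φ.1) (z : BallModel.Ball) :
    (((blockGL (ℝ ⊗[ℚ] M) (iPhi M Φ, sPhi M j Φ τ T z) : GL (Fin 1 ⊕ Fin 3) (ℝ ⊗[ℚ] M)) :
        Matrix (Fin 1 ⊕ Fin 3) (Fin 1 ⊕ Fin 3) (ℝ ⊗[ℚ] M)).map (embOf M σ)) =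
      Matrix.fromBlocks ((-Complex.I) • (1 : Matrix (Fin 1) (Fin 1) ℂ)) 0 0
        ((-Complex.I) • (sComp M j Φ τ T (BallModel.lift z) ⟨ComplexEmbedding.conjugate σ, h⟩).map (starRingEnd ℂ)) := by
  rw [coe_blockGL_iPhi_sPhi_map_embOf, embOf_iPhiVal_of_not_mem M Φ hσ, sMat_map_embOf_of_conjugate_mem M Φ j τ T _ σ h]

end AllEmbeddings

end Aux

end UnitaryCanonicalModel

end Literature.AlgebraicGeometry.ShimuraVarieties

end
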